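import Literature.Probability.FitznerVanDerHofstad2017.NobleKSpaceRewriteF
import Literature.Probability.FitznerVanDerHofstad2017.NobleBoundsN0Proofs
import HarnessLib

/-!
# [NoBLE17] App. D, Steps 2, 4 and 5 for `R_F` — module 3c-A: the weighted-`ℓ¹` convolution engine, the
parity classes of the coefficients, and the displacement constant `β_{ΔR_F}` of the Step-4 bookkeeping

Fitzner–van der Hofstad, *Generalized approach to the non-backtracking lace expansion*, Probab. Theory
Relat. Fields **169** (2017) 1041–1119 (= arXiv:1506.07969, "NoBLE17"), Appendix D: Step 2 (D.6)–(D.8)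
(pp. 1111–1112), Step 4 "Bound in terms of a convolution" (D.24)–(D.29) (pp. 1115–1116) and Step 5 (D.30)–(D.32)
(p. 1117); Assumptions 4.2–4.3 (pp. 1085–1088).

This module supplies the dimension-free analysis used by module 3c-B (`NobleKSpaceRewriteFRem.lean`) to
bound the weighted `ℓ¹`-norm `Σ_x ‖x‖₂² m(x)` of a TRS majorant `m` of the negative part of `R_F = F − F^α`:

* Part A — second moments of shifts and convolutions on `ℤ^d`: the parallelogram identity
  `‖y+u‖₂² + ‖y−u‖₂² = 2‖y‖₂² + 2‖u‖₂²`, the direction sums `Σ_κ ‖y − e_κ‖₂² = 2d(‖y‖₂² + 1)`,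
  `Σ_x f(x+v) = Σ f`, `Σ_x ‖x‖₂² f(x+v) = Σ_y ‖y−v‖₂² f(y)`, and for `f, g ≥ 0` with finite mass and second
  moment and `f` EVEN: `Σ_x (f⋆g)(x) = (Σ f)(Σ g)` and
  `Σ_x ‖x‖₂² (f⋆g)(x) = (Σ ‖·‖₂² f)(Σ g) + (Σ f)(Σ ‖·‖₂² g)` — this is (D.25)–(D.27) with the cross term
  `Σ_{y,z} 2(y·z) f(y) g(z) = 0` of (D.26) removed by the symmetry of `f` (here via the parallelogram law, so
  that no first moments are needed); domination of convolutions of differences of non-negative functions (the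
  sign bookkeeping of Step 5: "decompose all summands … into a negative and a positive part as the coefficients
  were defined via alternating sequences", p. 1117); total rotational symmetry of convolutions;
* Part B — the bundled "mass and displacement" predicate `MomentBound g L W` ((D.28)) and its closure under
  sums, multiples, shifts, direction sums, convolution with an even factor and series; linearity of `lconv`;
  the scalar majorant iteration `T_{n+1} = B ⋆ T_n` dominating the matrix iterates `A^n u` ((D.6)–(D.8)) with
  its moment bounds and the geometric tail sums of (D.29); the parity classes `Σ_N Ξ^{(M_N)}`,
  `Σ_N Ψ^{(M_N),κ}`, `Σ_N Ξ^{(M_N),ι}`, `Σ_N Π^{(M_N),ι,κ}` with their moment bounds from Assumption 4.3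
  (4.31)–(4.33), (4.49), the domination `Ψ ≤ (μ̄/μ)Ξ`, `Π ≤ μ̄ Ξ^ι` of Assumption 4.2 (4.29) on the classes, and
  the pointwise parity decompositions `Ψ^κ = Ψ^{[even]} − Ψ^{[odd]}`, `Π^{ι,κ} = Π^{(0)} − (Π^{[odd]} − Π^{[even≥2]})`;
* Part C — the constant `BetaMap.betaRfDeltaCorr` (same 27 arguments as the generated `BetaMap.betaRfDeltaLower`)
  that the Step-4 bookkeeping yields for (D.32), the table `BetaMap.nobleBetaOfInputsCorr` carrying it in the
  `βΔ` slot, and the `ring` identity `betaRfDeltaCorr_add_betaRfDeltaLower` relating it to the transcribed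
  display (programme note DIVERGENCE **D65**, HOME/DIVERGENCE.md, evidence `HOME/b2b-lace-oracle/g7/D32-LINE7.md`:
  for the cross terms `Ψ^ι ⋆ (A u)_ι` the bookkeeping pairs ALL FOUR parity combinations,
  `(1+μ²)(β^o_{ΔΞ}β^o_{Ξ^ι} + β^e_{ΔΞ}β^e_{Ξ^ι}) + 2μ(β^o_{ΔΞ}β^e_{Ξ^ι} + β^e_{ΔΞ}β^o_{Ξ^ι})`, at the coefficient
  `(2dμ̄)²/(1−μ²)²` printed in lines 8–9, where line 7 of the transcribed display carries
  `β^o_{ΔΞ}β^o_{Ξ^ι}(1+μ²) + 2μβ^e_{ΔΞ}β^e_{Ξ^ι}`).  The generated file `BetaMap.lean` is NOT modified.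

Nothing here is specific to a dimension; no numeral of record is touched.
-/

noncomputable section

namespace Literature.Probability.FitznerVanDerHofstad2017

open _root_.MeasureTheory _root_.Filter _root_.Topology Literature.Probability.LatticeModels
open Literature.Barriers.CriticalPhenomena Literature.Probability.Percolation
open scoped BigOperators

variable {d : ℕ}

/-! ## Part A. Second moments of shifts and convolutions on `ℤ^d` ([NoBLE17] App. D Step 4) -/

section Norms

local notation "𝐞" => Literature.Probability.Percolation.stepVec

/-- The parallelogram law on `ℤ^d`: `‖y+u‖₂² + ‖y−u‖₂² = 2‖y‖₂² + 2‖u‖₂²`. [folklore] -/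
theorem euclidNorm_sq_add_add_sq_sub (y u : Site d) :
    euclidNorm (y + u) ^ 2 + euclidNorm (y - u) ^ 2 = 2 * euclidNorm y ^ 2 + 2 * euclidNorm u ^ 2 := by
  simp only [euclidNorm_sq, Pi.add_apply, Pi.sub_apply, Int.cast_add, Int.cast_sub, Finset.mul_sum,
    ← Finset.sum_add_distrib]
  exact Finset.sum_congr rfl fun j _ => by ring

/-- `‖y+u‖₂² ≤ 2‖y‖₂² + 2‖u‖₂²` ([NoBLE17] (2.24) with `J = 2`). [cite: FitznerVanDerHofstad2016NoBLE, (2.24) (p. 1063)] -/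
theorem euclidNorm_sq_add_le (y u : Site d) :
    euclidNorm (y + u) ^ 2 ≤ 2 * euclidNorm y ^ 2 + 2 * euclidNorm u ^ 2 := by
  nlinarith [euclidNorm_sq_add_add_sq_sub y u, sq_nonneg (euclidNorm (y - u))]

/-- `‖y−u‖₂² ≤ 2‖y‖₂² + 2‖u‖₂²`. [cite: FitznerVanDerHofstad2016NoBLE, (2.24) (p. 1063)] -/
theorem euclidNorm_sq_sub_le (y u : Site d) :
    euclidNorm (y - u) ^ 2 ≤ 2 * euclidNorm y ^ 2 + 2 * euclidNorm u ^ 2 := by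
  nlinarith [euclidNorm_sq_add_add_sq_sub y u, sq_nonneg (euclidNorm (y + u))]

/-- `Σ_κ ‖y − e_κ‖₂² = 2d(‖y‖₂² + 1)` (the `± e_j` pair off by the parallelogram law; this is the source of the
factors `2d` and of the "`+ β_{Ξ^ι}`" companions of the `β_{ΔΞ^ι}` in (D.32)).
[cite: FitznerVanDerHofstad2016NoBLE, App. D (D.28) (p. 1116)] -/
theorem sum_dir_euclidNorm_sq_sub_stepVec (y : Site d) :
    ∑ κ : Fin d × Bool, euclidNorm (y - 𝐞 κ) ^ 2 = 2 * d * (euclidNorm y ^ 2 + 1) := by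
  rw [Fintype.sum_prod_type]
  have h : ∀ j : Fin d, ∑ b : Bool, euclidNorm (y - 𝐞 (j, b)) ^ 2 = 2 * euclidNorm y ^ 2 + 2 := by
    intro j
    rw [Fintype.sum_bool]
    have h1 : (𝐞 (j, false) : Site d) = -𝐞 (j, true) := by
      rw [← stepVec_srev]; rfl
    rw [h1, sub_neg_eq_add, add_comm, euclidNorm_sq_add_add_sq_sub, euclidNorm_stepVec, one_pow, mul_one]
  rw [Finset.sum_congr rfl fun j _ => h j, Finset.sum_const, Finset.card_univ, Fintype.card_fin, nsmul_eq_mul]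
  ring

/-- `Σ_κ ‖y + e_κ‖₂² = 2d(‖y‖₂² + 1)`. [cite: FitznerVanDerHofstad2016NoBLE, App. D (D.28) (p. 1116)] -/
theorem sum_dir_euclidNorm_sq_add_stepVec (y : Site d) :
    ∑ κ : Fin d × Bool, euclidNorm (y + 𝐞 κ) ^ 2 = 2 * d * (euclidNorm y ^ 2 + 1) := by
  rw [← sum_dir_euclidNorm_sq_sub_stepVec y]
  exact Fintype.sum_equiv (srevEquiv d) _ _ fun κ => by
    show euclidNorm (y + 𝐞 κ) ^ 2 = euclidNorm (y - 𝐞 (srev κ)) ^ 2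
    rw [stepVec_srev, sub_neg_eq_add]

end Norms

section Shifts

local notation "𝐞" => Literature.Probability.Percolation.stepVec

/-- `Σ_x f(x + v) = Σ_x f(x)`. [folklore] -/
theorem tsum_comp_add_right' (f : Site d → ℝ) (v : Site d) : ∑' x, f (x + v) = ∑' x, f x :=
  (Equiv.addRight v).tsum_eq f

/-- `x ↦ f(x + v)` is summable iff `f` is. [folklore] -/
theorem summable_comp_add_right_iff {f : Site d → ℝ} (v : Site d) :
    (Summable fun x => f (x + v)) ↔ Summable f :=
  (Equiv.addRight v).summable_iff

/-- `Σ_x ‖x‖₂² f(x + v) = Σ_y ‖y − v‖₂² f(y)`. [folklore] -/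
theorem tsum_sq_mul_comp_add_right (f : Site d → ℝ) (v : Site d) :
    ∑' x, euclidNorm x ^ 2 * f (x + v) = ∑' y, euclidNorm (y - v) ^ 2 * f y := by
  rw [← (Equiv.addRight v).tsum_eq fun y => euclidNorm (y - v) ^ 2 * f y]
  exact tsum_congr fun x => by simp

/-- `x ↦ ‖x‖₂² f(x + v)` is summable iff `y ↦ ‖y − v‖₂² f(y)` is. [folklore] -/
theorem summable_sq_mul_comp_add_right_iff {f : Site d → ℝ} (v : Site d) :
    (Summable fun x => euclidNorm x ^ 2 * f (x + v)) ↔ Summable fun y => euclidNorm (y - v) ^ 2 * f y := by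
  have h : (fun x => euclidNorm x ^ 2 * f (x + v)) =
      (fun y => euclidNorm (y - v) ^ 2 * f y) ∘ (Equiv.addRight v) := by
    funext x; simp
  rw [h]
  exact (Equiv.addRight v).summable_iff

/-- For `f ≥ 0` with finite mass and second moment, every shifted second moment is finite:
`y ↦ ‖y − v‖₂² f(y)` is summable. [cite: FitznerVanDerHofstad2016NoBLE, (2.24) (p. 1063)] -/
theorem summable_sq_sub_mul {f : Site d → ℝ} (hf0 : ∀ y, 0 ≤ f y) (hf : Summable f)
    (hfW : Summable fun y => euclidNorm y ^ 2 * f y) (v : Site d) :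
    Summable fun y => euclidNorm (y - v) ^ 2 * f y :=
  Summable.of_nonneg_of_le (fun y => mul_nonneg (sq_nonneg _) (hf0 y))
    (fun y => by
      calc euclidNorm (y - v) ^ 2 * f y ≤ (2 * euclidNorm y ^ 2 + 2 * euclidNorm v ^ 2) * f y :=
            mul_le_mul_of_nonneg_right (euclidNorm_sq_sub_le y v) (hf0 y)
        _ = 2 * (euclidNorm y ^ 2 * f y) + 2 * euclidNorm v ^ 2 * f y := by ring)
    ((hfW.mul_left 2).add (hf.mul_left (2 * euclidNorm v ^ 2)))

/-- … with the bound `Σ_y ‖y − v‖₂² f(y) ≤ 2 Σ ‖·‖₂² f + 2‖v‖₂² Σ f`. [cite: FitznerVanDerHofstad2016NoBLE, (2.24) (p. 1063)] -/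
theorem tsum_sq_sub_mul_le {f : Site d → ℝ} (hf0 : ∀ y, 0 ≤ f y) (hf : Summable f)
    (hfW : Summable fun y => euclidNorm y ^ 2 * f y) (v : Site d) :
    ∑' y, euclidNorm (y - v) ^ 2 * f y ≤
      2 * (∑' y, euclidNorm y ^ 2 * f y) + 2 * euclidNorm v ^ 2 * ∑' y, f y := by
  have h := (summable_sq_sub_mul hf0 hf hfW v).tsum_le_tsum
    (fun y => show euclidNorm (y - v) ^ 2 * f y ≤ 2 * (euclidNorm y ^ 2 * f y) + 2 * euclidNorm v ^ 2 * f y by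
      calc euclidNorm (y - v) ^ 2 * f y ≤ (2 * euclidNorm y ^ 2 + 2 * euclidNorm v ^ 2) * f y :=
            mul_le_mul_of_nonneg_right (euclidNorm_sq_sub_le y v) (hf0 y)
        _ = 2 * (euclidNorm y ^ 2 * f y) + 2 * euclidNorm v ^ 2 * f y := by ring)
    ((hfW.mul_left 2).add (hf.mul_left (2 * euclidNorm v ^ 2)))
  rw [(hfW.mul_left 2).tsum_add (hf.mul_left (2 * euclidNorm v ^ 2)), tsum_mul_left, tsum_mul_left] at h
  exact h

/-- The same with `+v`: `y ↦ ‖y + v‖₂² f(y)` is summable. [cite: FitznerVanDerHofstad2016NoBLE, (2.24) (p. 1063)] -/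
theorem summable_sq_add_mul {f : Site d → ℝ} (hf0 : ∀ y, 0 ≤ f y) (hf : Summable f)
    (hfW : Summable fun y => euclidNorm y ^ 2 * f y) (v : Site d) :
    Summable fun y => euclidNorm (y + v) ^ 2 * f y := by
  simpa [sub_neg_eq_add] using summable_sq_sub_mul hf0 hf hfW (-v)

/-- `Σ_y ‖y + v‖₂² f(y) ≤ 2 Σ ‖·‖₂² f + 2‖v‖₂² Σ f`. [cite: FitznerVanDerHofstad2016NoBLE, (2.24) (p. 1063)] -/
theorem tsum_sq_add_mul_le {f : Site d → ℝ} (hf0 : ∀ y, 0 ≤ f y) (hf : Summable f)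
    (hfW : Summable fun y => euclidNorm y ^ 2 * f y) (v : Site d) :
    ∑' y, euclidNorm (y + v) ^ 2 * f y ≤
      2 * (∑' y, euclidNorm y ^ 2 * f y) + 2 * euclidNorm v ^ 2 * ∑' y, f y := by
  simpa [sub_neg_eq_add, euclidNorm_neg] using tsum_sq_sub_mul_le hf0 hf hfW (-v)

/-- `x ↦ ‖x‖₂² f(x + v)` is summable for `f ≥ 0` of finite mass and second moment. [cite: FitznerVanDerHofstad2016NoBLE, App. D (D.28) (p. 1116)] -/
theorem summable_sq_mul_comp_add_right {f : Site d → ℝ} (hf0 : ∀ y, 0 ≤ f y) (hf : Summable f)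
    (hfW : Summable fun y => euclidNorm y ^ 2 * f y) (v : Site d) :
    Summable fun x => euclidNorm x ^ 2 * f (x + v) :=
  (summable_sq_mul_comp_add_right_iff v).2 (summable_sq_sub_mul hf0 hf hfW v)

/-- **`Σ_κ Σ_x ‖x‖₂² f(x + e_κ) = 2d (Σ_y ‖y‖₂² f(y) + Σ_y f(y))`** for `f ≥ 0` of finite mass and second
moment. [cite: FitznerVanDerHofstad2016NoBLE, App. D (D.28) (p. 1116)] -/
theorem sum_dir_tsum_sq_mul_comp_add_stepVec {f : Site d → ℝ} (hf0 : ∀ y, 0 ≤ f y) (hf : Summable f)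
    (hfW : Summable fun y => euclidNorm y ^ 2 * f y) :
    ∑ κ : Fin d × Bool, ∑' x, euclidNorm x ^ 2 * f (x + 𝐞 κ) =
      2 * d * ((∑' y, euclidNorm y ^ 2 * f y) + ∑' y, f y) := by
  simp_rw [tsum_sq_mul_comp_add_right]
  rw [← Summable.tsum_finsetSum (fun κ _ => summable_sq_sub_mul hf0 hf hfW (𝐞 κ))]
  simp_rw [← Finset.sum_mul, sum_dir_euclidNorm_sq_sub_stepVec]
  have h : ∀ b : Site d, 2 * (d : ℝ) * (euclidNorm b ^ 2 + 1) * f b =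
      2 * d * (euclidNorm b ^ 2 * f b) + 2 * d * f b := fun b => by ring
  simp_rw [h]
  rw [(hfW.mul_left _).tsum_add (hf.mul_left _), tsum_mul_left, tsum_mul_left]
  ring

/-- The doubly shifted form: `Σ_κ Σ_x ‖x‖₂² f(x + v + e_κ) = 2d (Σ_y ‖y − v‖₂² f(y) + Σ_y f(y))`.
[cite: FitznerVanDerHofstad2016NoBLE, App. D (D.28) (p. 1116)] -/
theorem sum_dir_tsum_sq_mul_comp_add_add_stepVec {f : Site d → ℝ} (hf0 : ∀ y, 0 ≤ f y) (hf : Summable f)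
    (hfW : Summable fun y => euclidNorm y ^ 2 * f y) (v : Site d) :
    ∑ κ : Fin d × Bool, ∑' x, euclidNorm x ^ 2 * f (x + v + 𝐞 κ) =
      2 * d * ((∑' y, euclidNorm (y - v) ^ 2 * f y) + ∑' y, f y) := by
  have hg0 : ∀ y, 0 ≤ f (y + v) := fun y => hf0 _
  have hg : Summable fun y => f (y + v) := (summable_comp_add_right_iff v).2 hf
  have hgW : Summable fun y => euclidNorm y ^ 2 * f (y + v) := summable_sq_mul_comp_add_right hf0 hf hfW v
  have h := sum_dir_tsum_sq_mul_comp_add_stepVec hg0 hg hgW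
  simp_rw [add_right_comm _ (𝐞 _) v] at h
  rw [h, tsum_sq_mul_comp_add_right, tsum_comp_add_right']

end Shifts

section Conv

local notation "𝐞" => Literature.Probability.Percolation.stepVec

/-! ### Mass and second moment of a convolution ([NoBLE17] (D.25)–(D.27)) -/

/-- The family `(u, x) ↦ f(u) g(x − u)` is summable for `f, g ∈ ℓ¹`. [folklore] -/
theorem summable_uncurry_lconv {f g : Site d → ℝ} (hf : Summable fun x => |f x|)
    (hg : Summable fun x => |g x|) :
    Summable (Function.uncurry fun (u x : Site d) => f u * g (x - u)) :=
  Summable.of_norm_bounded (summable_uncurry_abs_conv (summable_abs_iff.1 hf) (summable_abs_iff.1 hg))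
    fun q => by
      rw [Real.norm_eq_abs]
      show |f q.1 * g (q.2 - q.1)| ≤ |f q.1| * |g (q.2 - q.1)|
      rw [abs_mul]

/-- **`Σ_x (f⋆g)(x) = (Σ f)(Σ g)`** for `f, g ∈ ℓ¹`: the mass of a convolution is the product of the masses,
(D.25)–(D.26) for the `‖·‖`-free part. [cite: FitznerVanDerHofstad2016NoBLE, App. D (D.26) (p. 1116)] -/
theorem tsum_lconv {f g : Site d → ℝ} (hf : Summable fun x => |f x|) (hg : Summable fun x => |g x|) :
    ∑' x, lconv f g x = (∑' x, f x) * ∑' x, g x := by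
  unfold lconv
  rw [(summable_uncurry_lconv hf hg).tsum_comm]
  simp_rw [tsum_mul_left, tsum_sub_arg]
  exact tsum_mul_right

/-- One row of the weighted double sum: `Σ_x ‖x‖₂² f(u) g(x−u) = f(u) Σ_y ‖y+u‖₂² g(y)`. [folklore] -/
theorem tsum_sq_mul_mul_comp_sub (f g : Site d → ℝ) (u : Site d) :
    ∑' x, euclidNorm x ^ 2 * (f u * g (x - u)) = f u * ∑' y, euclidNorm (y + u) ^ 2 * g y := by
  calc ∑' x, euclidNorm x ^ 2 * (f u * g (x - u))
      = ∑' x, f u * (euclidNorm x ^ 2 * g (x + -u)) := tsum_congr fun x => by rw [← sub_eq_add_neg]; ring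
    _ = f u * ∑' x, euclidNorm x ^ 2 * g (x + -u) := tsum_mul_left
    _ = f u * ∑' y, euclidNorm (y - -u) ^ 2 * g y := by rw [tsum_sq_mul_comp_add_right]
    _ = f u * ∑' y, euclidNorm (y + u) ^ 2 * g y := by simp only [sub_neg_eq_add]

/-- The family `(u, x) ↦ ‖x‖₂² f(u) g(x−u)` is summable for `f, g ≥ 0` of finite mass and second moment
(Fubini for (D.25)). [cite: FitznerVanDerHofstad2016NoBLE, App. D (D.25)–(D.27) (p. 1116)] -/
theorem summable_uncurry_sq_lconv {f g : Site d → ℝ} (hf0 : ∀ x, 0 ≤ f x) (hg0 : ∀ x, 0 ≤ g x)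
    (hf : Summable f) (hg : Summable g) (hfW : Summable fun x => euclidNorm x ^ 2 * f x)
    (hgW : Summable fun x => euclidNorm x ^ 2 * g x) :
    Summable (Function.uncurry fun (u x : Site d) => euclidNorm x ^ 2 * (f u * g (x - u))) := by
  refine (summable_prod_of_nonneg fun q => ?_).2 ⟨fun u => ?_, ?_⟩
  · exact mul_nonneg (sq_nonneg _) (mul_nonneg (hf0 _) (hg0 _))
  · refine ((summable_sq_mul_comp_add_right hg0 hg hgW (-u)).mul_left (f u)).congr fun x => ?_
    show f u * (euclidNorm x ^ 2 * g (x + -u)) = euclidNorm x ^ 2 * (f u * g (x - u))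
    rw [← sub_eq_add_neg]; ring
  · show Summable fun u => ∑' x, euclidNorm x ^ 2 * (f u * g (x - u))
    simp only [tsum_sq_mul_mul_comp_sub]
    refine Summable.of_nonneg_of_le
      (fun u => mul_nonneg (hf0 u) (tsum_nonneg fun y => mul_nonneg (sq_nonneg _) (hg0 y)))
      (fun u => mul_le_mul_of_nonneg_left (tsum_sq_add_mul_le hg0 hg hgW u) (hf0 u)) ?_
    have h : (fun u => f u * (2 * (∑' y, euclidNorm y ^ 2 * g y) + 2 * euclidNorm u ^ 2 * ∑' y, g y)) =
        fun u => (2 * ∑' y, euclidNorm y ^ 2 * g y) * f u + (2 * ∑' y, g y) * (euclidNorm u ^ 2 * f u) := by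
      funext u; ring
    rw [h]
    exact (hf.mul_left _).add (hfW.mul_left _)

/-- `Σ_x ‖x‖₂² (f⋆g)(x) = Σ_u f(u) Σ_y ‖y+u‖₂² g(y)` ((D.25) after substituting `x = y + u`).
[cite: FitznerVanDerHofstad2016NoBLE, App. D (D.25) (p. 1116)] -/
theorem tsum_sq_mul_lconv_eq {f g : Site d → ℝ} (hf0 : ∀ x, 0 ≤ f x) (hg0 : ∀ x, 0 ≤ g x)
    (hf : Summable f) (hg : Summable g) (hfW : Summable fun x => euclidNorm x ^ 2 * f x)
    (hgW : Summable fun x => euclidNorm x ^ 2 * g x) :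
    ∑' x, euclidNorm x ^ 2 * lconv f g x = ∑' u, f u * ∑' y, euclidNorm (y + u) ^ 2 * g y := by
  unfold lconv
  have h1 : ∀ x, euclidNorm x ^ 2 * ∑' u, f u * g (x - u) = ∑' u, euclidNorm x ^ 2 * (f u * g (x - u)) :=
    fun x => tsum_mul_left.symm
  simp only [h1]
  rw [(summable_uncurry_sq_lconv hf0 hg0 hf hg hfW hgW).tsum_comm]
  exact tsum_congr fun u => tsum_sq_mul_mul_comp_sub f g u

/-- The weighted mass of a convolution is summable: `x ↦ ‖x‖₂² (f⋆g)(x) ∈ ℓ¹`.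
[cite: FitznerVanDerHofstad2016NoBLE, App. D (D.25)–(D.27) (p. 1116)] -/
theorem summable_sq_mul_lconv {f g : Site d → ℝ} (hf0 : ∀ x, 0 ≤ f x) (hg0 : ∀ x, 0 ≤ g x)
    (hf : Summable f) (hg : Summable g) (hfW : Summable fun x => euclidNorm x ^ 2 * f x)
    (hgW : Summable fun x => euclidNorm x ^ 2 * g x) :
    Summable fun x => euclidNorm x ^ 2 * lconv f g x := by
  have h := (summable_uncurry_sq_lconv hf0 hg0 hf hg hfW hgW).prod_symm.prod
  refine h.congr fun x => ?_
  show ∑' u, euclidNorm x ^ 2 * (f u * g (x - u)) = euclidNorm x ^ 2 * lconv f g x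
  unfold lconv
  exact tsum_mul_left

/-- A convolution of non-negative summable functions is summable. [folklore] -/
theorem summable_lconv {f g : Site d → ℝ} (hf : Summable fun x => |f x|) (hg : Summable fun x => |g x|) :
    Summable (lconv f g) :=
  summable_abs_iff.1 (summable_abs_lconv hf hg)

/-- **Second moment of a convolution with an even factor** ((D.25)–(D.27) with the cross term
`2 Σ_{y,z} (y·z) f(y) g(z) = 0` of (D.26) removed by the symmetry `f(−y) = f(y)`):
`Σ_x ‖x‖₂² (f⋆g)(x) = (Σ ‖·‖₂² f)(Σ g) + (Σ f)(Σ ‖·‖₂² g)`.  The proof symmetrises `u ↦ −u` and uses the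
parallelogram law, so no first moments are needed. [cite: FitznerVanDerHofstad2016NoBLE, App. D (D.25)–(D.27) (p. 1116)] -/
theorem tsum_sq_mul_lconv {f g : Site d → ℝ} (hf0 : ∀ x, 0 ≤ f x) (hg0 : ∀ x, 0 ≤ g x)
    (hf : Summable f) (hg : Summable g) (hfW : Summable fun x => euclidNorm x ^ 2 * f x)
    (hgW : Summable fun x => euclidNorm x ^ 2 * g x) (hfe : ∀ x, f (-x) = f x) :
    ∑' x, euclidNorm x ^ 2 * lconv f g x =
      (∑' x, euclidNorm x ^ 2 * f x) * (∑' x, g x) + (∑' x, f x) * ∑' x, euclidNorm x ^ 2 * g x := by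
  rw [tsum_sq_mul_lconv_eq hf0 hg0 hf hg hfW hgW]
  set P : Site d → ℝ := fun u => ∑' y, euclidNorm (y + u) ^ 2 * g y with hP
  set M : Site d → ℝ := fun u => ∑' y, euclidNorm (y - u) ^ 2 * g y with hM
  have hbound : ∀ u, P u + M u = 2 * (∑' y, euclidNorm y ^ 2 * g y) + 2 * euclidNorm u ^ 2 * ∑' y, g y := by
    intro u
    simp only [hP, hM]
    rw [← (summable_sq_add_mul hg0 hg hgW u).tsum_add (summable_sq_sub_mul hg0 hg hgW u)]
    have h2 : ∀ y, euclidNorm (y + u) ^ 2 * g y + euclidNorm (y - u) ^ 2 * g y =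
        2 * (euclidNorm y ^ 2 * g y) + 2 * euclidNorm u ^ 2 * g y := fun y => by
      rw [← add_mul, euclidNorm_sq_add_add_sq_sub]; ring
    simp only [h2]
    rw [(hgW.mul_left 2).tsum_add (hg.mul_left _), tsum_mul_left, tsum_mul_left]
  have hPs : Summable fun u => f u * P u :=
    Summable.of_nonneg_of_le
      (fun u => mul_nonneg (hf0 u) (tsum_nonneg fun y => mul_nonneg (sq_nonneg _) (hg0 y)))
      (fun u => mul_le_mul_of_nonneg_left (tsum_sq_add_mul_le hg0 hg hgW u) (hf0 u))
      (by
        have h : (fun u => f u * (2 * (∑' y, euclidNorm y ^ 2 * g y) + 2 * euclidNorm u ^ 2 * ∑' y, g y)) =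
            fun u => (2 * ∑' y, euclidNorm y ^ 2 * g y) * f u + (2 * ∑' y, g y) * (euclidNorm u ^ 2 * f u) := by
          funext u; ring
        rw [h]
        exact (hf.mul_left _).add (hfW.mul_left _))
  have hMs : Summable fun u => f u * M u :=
    Summable.of_nonneg_of_le
      (fun u => mul_nonneg (hf0 u) (tsum_nonneg fun y => mul_nonneg (sq_nonneg _) (hg0 y)))
      (fun u => mul_le_mul_of_nonneg_left (tsum_sq_sub_mul_le hg0 hg hgW u) (hf0 u))
      (by
        have h : (fun u => f u * (2 * (∑' y, euclidNorm y ^ 2 * g y) + 2 * euclidNorm u ^ 2 * ∑' y, g y)) =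
            fun u => (2 * ∑' y, euclidNorm y ^ 2 * g y) * f u + (2 * ∑' y, g y) * (euclidNorm u ^ 2 * f u) := by
          funext u; ring
        rw [h]
        exact (hf.mul_left _).add (hfW.mul_left _))
  -- symmetrisation `u ↦ −u`: `Σ f P = Σ f M`
  have hsym : ∑' u, f u * P u = ∑' u, f u * M u := by
    rw [← (Equiv.neg (Site d)).tsum_eq fun u => f u * M u]
    refine tsum_congr fun u => ?_
    simp only [Equiv.neg_apply, hfe, hM, hP, sub_neg_eq_add]
  have h2 : 2 * ∑' u, f u * P u = ∑' u, f u * (P u + M u) := by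
    rw [two_mul]
    nth_rewrite 2 [hsym]
    rw [← hPs.tsum_add hMs]
    exact tsum_congr fun u => by ring
  have h3 : ∑' u, f u * (P u + M u) =
      2 * ((∑' x, euclidNorm x ^ 2 * f x) * (∑' x, g x) + (∑' x, f x) * ∑' x, euclidNorm x ^ 2 * g x) := by
    simp only [hbound]
    have h : ∀ u, f u * (2 * (∑' y, euclidNorm y ^ 2 * g y) + 2 * euclidNorm u ^ 2 * ∑' y, g y) =
        (2 * ∑' y, euclidNorm y ^ 2 * g y) * f u + (2 * ∑' y, g y) * (euclidNorm u ^ 2 * f u) := fun u => by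
      ring
    simp only [h]
    rw [(hf.mul_left _).tsum_add (hfW.mul_left _), tsum_mul_left, tsum_mul_left]
    ring
  linarith

/-! ### Domination of convolutions ([NoBLE17] App. D Step 5: sign bookkeeping) -/

/-- `(f − g) ⋆ h = f⋆h − g⋆h` for `f, g, h ∈ ℓ¹`. [folklore] -/
theorem lconv_sub_left_abs {f g h : Site d → ℝ} (hf : Summable fun x => |f x|) (hg : Summable fun x => |g x|)
    (hh : Summable fun x => |h x|) (x : Site d) :
    lconv (fun z => f z - g z) h x = lconv f h x - lconv g h x := by
  unfold lconv
  simp only [sub_mul]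
  exact (summable_mul_shift hf hh x).tsum_sub (summable_mul_shift hg hh x)

/-- A convolution of non-negative functions is non-negative. [folklore] -/
theorem lconv_nonneg {f g : Site d → ℝ} (hf0 : ∀ x, 0 ≤ f x) (hg0 : ∀ x, 0 ≤ g x) (x : Site d) :
    0 ≤ lconv f g x :=
  tsum_nonneg fun y => mul_nonneg (hf0 y) (hg0 _)

/-- `|f⋆g| ≤ F⋆G` pointwise when `|f| ≤ F`, `|g| ≤ G` with `F, G ∈ ℓ¹`. [folklore] -/
theorem abs_lconv_le_lconv {f g F G : Site d → ℝ} (hfF : ∀ x, |f x| ≤ F x) (hgG : ∀ x, |g x| ≤ G x)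
    (hF : Summable F) (hG : Summable G) (x : Site d) : |lconv f g x| ≤ lconv F G x := by
  have hF' : Summable fun x => |F x| := hF.abs
  have hG' : Summable fun x => |G x| := hG.abs
  have hFa : ∀ x, |F x| = F x := fun x => abs_of_nonneg ((abs_nonneg _).trans (hfF x))
  have hGa : ∀ x, |G x| = G x := fun x => abs_of_nonneg ((abs_nonneg _).trans (hgG x))
  unfold lconv
  refine (abs_tsum_le_tsum_abs' ?_).trans ?_
  · exact summable_mul_shift (Summable.of_nonneg_of_le (fun _ => abs_nonneg _) hfF hF)
      (Summable.of_nonneg_of_le (fun _ => abs_nonneg _) hgG hG) x |>.abs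
  · refine Summable.tsum_le_tsum (fun y => ?_) ?_ (summable_mul_shift hF' hG' x)
    · rw [abs_mul]; exact mul_le_mul (hfF y) (hgG _) (abs_nonneg _) ((abs_nonneg _).trans (hfF y))
    · exact (summable_mul_shift (Summable.of_nonneg_of_le (fun _ => abs_nonneg _) hfF hF)
        (Summable.of_nonneg_of_le (fun _ => abs_nonneg _) hgG hG) x).abs

/-- Monotonicity: `0 ≤ f ≤ F`, `0 ≤ g ≤ G` (`F, G ∈ ℓ¹`) ⇒ `f⋆g ≤ F⋆G`. [folklore] -/
theorem lconv_mono {f g F G : Site d → ℝ} (hf0 : ∀ x, 0 ≤ f x) (hfF : ∀ x, f x ≤ F x)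
    (hg0 : ∀ x, 0 ≤ g x) (hgG : ∀ x, g x ≤ G x) (hF : Summable F) (hG : Summable G) (x : Site d) :
    lconv f g x ≤ lconv F G x := by
  have h := abs_lconv_le_lconv (fun x => by rw [abs_of_nonneg (hf0 x)]; exact hfF x)
    (fun x => by rw [abs_of_nonneg (hg0 x)]; exact hgG x) hF hG x
  exact (le_abs_self _).trans h

/-- **Parity domination, positive side.** For `a = aE − aO`, `b = bE − bO` with all four parts non-negative and
dominated by `ℓ¹` majorants `AE, AO, BE, BO`: `a⋆b ≤ AE⋆BE + AO⋆BO` ("decompose all summands … into a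
negative and a positive part as the coefficients were defined via alternating sequences", Step 5).
[cite: FitznerVanDerHofstad2016NoBLE, App. D Step 5 (p. 1117)] -/
theorem lconv_sub_sub_le {aE aO bE bO AE AO BE BO : Site d → ℝ}
    (haE : ∀ x, 0 ≤ aE x) (haO : ∀ x, 0 ≤ aO x) (hbE : ∀ x, 0 ≤ bE x) (hbO : ∀ x, 0 ≤ bO x)
    (hAE : ∀ x, aE x ≤ AE x) (hAO : ∀ x, aO x ≤ AO x) (hBE : ∀ x, bE x ≤ BE x) (hBO : ∀ x, bO x ≤ BO x)
    (sAE : Summable AE) (sAO : Summable AO) (sBE : Summable BE) (sBO : Summable BO) (x : Site d) :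
    lconv (fun y => aE y - aO y) (fun y => bE y - bO y) x ≤ lconv AE BE x + lconv AO BO x := by
  have saE : Summable fun x => |aE x| :=
    (Summable.of_nonneg_of_le haE hAE sAE).abs
  have saO : Summable fun x => |aO x| :=
    (Summable.of_nonneg_of_le haO hAO sAO).abs
  have sbE : Summable fun x => |bE x| :=
    (Summable.of_nonneg_of_le hbE hBE sBE).abs
  have sbO : Summable fun x => |bO x| :=
    (Summable.of_nonneg_of_le hbO hBO sBO).abs
  have sb : Summable fun y => |bE y - bO y| :=
    summable_abs_iff.2 ((summable_abs_iff.1 sbE).sub (summable_abs_iff.1 sbO))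
  rw [lconv_sub_left_abs saE saO sb x, lconv_sub_right_abs saE sbE sbO x, lconv_sub_right_abs saO sbE sbO x]
  have h1 := lconv_mono haE hAE hbE hBE sAE sBE x
  have h2 := lconv_mono haO hAO hbO hBO sAO sBO x
  have h3 := lconv_nonneg haE hbO x
  have h4 := lconv_nonneg haO hbE x
  linarith

/-- **Parity domination, negative side**: `−(a⋆b) ≤ AE⋆BO + AO⋆BE`.
[cite: FitznerVanDerHofstad2016NoBLE, App. D Step 5 (p. 1117)] -/
theorem neg_lconv_sub_sub_le {aE aO bE bO AE AO BE BO : Site d → ℝ}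
    (haE : ∀ x, 0 ≤ aE x) (haO : ∀ x, 0 ≤ aO x) (hbE : ∀ x, 0 ≤ bE x) (hbO : ∀ x, 0 ≤ bO x)
    (hAE : ∀ x, aE x ≤ AE x) (hAO : ∀ x, aO x ≤ AO x) (hBE : ∀ x, bE x ≤ BE x) (hBO : ∀ x, bO x ≤ BO x)
    (sAE : Summable AE) (sAO : Summable AO) (sBE : Summable BE) (sBO : Summable BO) (x : Site d) :
    -lconv (fun y => aE y - aO y) (fun y => bE y - bO y) x ≤ lconv AE BO x + lconv AO BE x := by
  have saE : Summable fun x => |aE x| :=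
    (Summable.of_nonneg_of_le haE hAE sAE).abs
  have saO : Summable fun x => |aO x| :=
    (Summable.of_nonneg_of_le haO hAO sAO).abs
  have sbE : Summable fun x => |bE x| :=
    (Summable.of_nonneg_of_le hbE hBE sBE).abs
  have sbO : Summable fun x => |bO x| :=
    (Summable.of_nonneg_of_le hbO hBO sBO).abs
  have sb : Summable fun y => |bE y - bO y| :=
    summable_abs_iff.2 ((summable_abs_iff.1 sbE).sub (summable_abs_iff.1 sbO))
  rw [lconv_sub_left_abs saE saO sb x, lconv_sub_right_abs saE sbE sbO x, lconv_sub_right_abs saO sbE sbO x]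
  have h1 := lconv_mono haE hAE hbO hBO sAE sBO x
  have h2 := lconv_mono haO hAO hbE hBE sAO sBE x
  have h3 := lconv_nonneg haE hbE x
  have h4 := lconv_nonneg haO hbO x
  linarith

/-! ### Symmetry of convolutions and of transported families -/

/-- A TRS function is invariant under every signed coordinate permutation. [cite: FitznerVanDerHofstad2016NoBLE, Def. 2.5 (p. 1058)] -/
theorem IsTRS.apply_zdSignedPermIso {f : Site d → ℝ} (hf : IsTRS f) (π : Equiv.Perm (Fin d))
    (ε : Fin d → ℤˣ) (z : Site d) : f (zdSignedPermIso π ε z) = f z := by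
  rw [zdSignedPermIso_apply]; exact hf.isZdSymmetric π ε z

/-- A TRS function is even. [cite: FitznerVanDerHofstad2016NoBLE, Def. 2.5 (p. 1058)] -/
theorem IsTRS.apply_neg {f : Site d → ℝ} (hf : IsTRS f) (z : Site d) : f (-z) = f z := by
  have h := hf.apply_zdSignedPermIso (Equiv.refl _) (fun _ => -1) z
  have e : zdSignedPermIso (Equiv.refl (Fin d)) (fun _ => (-1 : ℤˣ)) z = -z := by
    funext j; simp [zdSignedPermIso_apply, Site.signedPerm]
  rwa [e] at h

/-- Transport of a convolution under a signed permutation `σ`: `(f⋆g)(σx) = (f∘σ ⋆ g∘σ)(x)`. [folklore] -/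
theorem lconv_zdSignedPermIso (π : Equiv.Perm (Fin d)) (ε : Fin d → ℤˣ) {f g f' g' : Site d → ℝ}
    (hf : ∀ y, f (zdSignedPermIso π ε y) = f' y) (hg : ∀ y, g (zdSignedPermIso π ε y) = g' y)
    (x : Site d) : lconv f g (zdSignedPermIso π ε x) = lconv f' g' x := by
  unfold lconv
  rw [← (zdSignedPermIso π ε).toEquiv.tsum_eq (fun y => f y * g (zdSignedPermIso π ε x - y))]
  refine tsum_congr fun y => ?_
  show f (zdSignedPermIso π ε y) * g (zdSignedPermIso π ε x - zdSignedPermIso π ε y) = f' y * g' (x - y)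
  rw [← zdSignedPermIso_sub, hf, hg]

/-- The convolution of two TRS functions is TRS. [cite: FitznerVanDerHofstad2016NoBLE, Def. 2.5 (p. 1058)] -/
theorem IsTRS.lconv {f g : Site d → ℝ} (hf : IsTRS f) (hg : IsTRS g) : IsTRS (lconv f g) :=
  isTRS_of_relabel _ fun π ε x =>
    lconv_zdSignedPermIso π ε (fun y => hf.apply_zdSignedPermIso π ε y) (fun y => hg.apply_zdSignedPermIso π ε y) x

/-- A series of TRS functions is TRS. [folklore] -/
theorem isTRS_tsum {F : ℕ → Site d → ℝ} (hF : ∀ N, IsTRS (F N)) : IsTRS (fun x => ∑' N, F N x) :=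
  fun ν δ x => tsum_congr fun N => hF N ν δ x

/-- The shifted direction sum `x ↦ Σ_κ f(x + e_κ)` of a TRS function is TRS. [cite: FitznerVanDerHofstad2017, §3.5 (arXiv:1506.07977v2 p. 32; EJP pp. 29–30)] -/
theorem IsTRS.sum_dir_comp_add_stepVec {f : Site d → ℝ} (hf : IsTRS f) :
    IsTRS (fun x => ∑ κ : Fin d × Bool, f (x + 𝐞 κ)) :=
  isTRS_sum_of_relabel (fun e x => f (x + e)) fun π ε e x => by
    show f (zdSignedPermIso π ε x + zdSignedPermIso π ε e) = f (x + e)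
    rw [← zdSignedPermIso_add, hf.apply_zdSignedPermIso]

end Conv

/-! ## Part B. Bundled moment bounds and the parity classes of the coefficients

[NoBLE17] App. D (D.28): "each term of `F_{z,n}` is a convolution of `2n + 1` quantities, e.g. `Π^{ι,κ}_z`,
whose total mass and displacement are bounded by the quantities given in Assumption 4.3" — formalised as a
bundled predicate `MomentBound g L W` (`g ≥ 0`, `Σ g ≤ L`, `Σ ‖·‖₂² g ≤ W`) closed under sums, shifts, direction
sums, convolutions with an even factor and series, and instantiated on the parity classes
`Σ_N Ξ^{(M_N)}`, `Σ_N Ξ^{(M_N),ι}` of the coefficients from Assumption 4.3 (4.31)–(4.33), (4.49). -/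

section Moments

local notation "𝐞" => Literature.Probability.Percolation.stepVec

/-- **Mass-and-displacement bound** of a non-negative lattice function: `g ≥ 0`, `g ∈ ℓ¹` with `Σ_x g(x) ≤ L`
and `Σ_x ‖x‖₂² g(x) ≤ W` (finite "total mass and displacement", App. D Step 4).
[cite: FitznerVanDerHofstad2016NoBLE, App. D Step 4, (D.28) (p. 1116); Assumption 4.3 (4.31)–(4.32) (p. 1086)] -/
structure MomentBound (g : Site d → ℝ) (L W : ℝ) : Prop where
  nonneg : ∀ x, 0 ≤ g x
  summable : Summable g
  tsum_le : ∑' x, g x ≤ L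
  summableW : Summable fun x => euclidNorm x ^ 2 * g x
  tsumW_le : ∑' x, euclidNorm x ^ 2 * g x ≤ W

namespace MomentBound

variable {f g : Site d → ℝ} {L W L' W' L₁ W₁ L₂ W₂ : ℝ}

/-- [folklore] -/
theorem L_nonneg (h : MomentBound g L W) : 0 ≤ L := (tsum_nonneg h.nonneg).trans h.tsum_le

/-- [folklore] -/
theorem W_nonneg (h : MomentBound g L W) : 0 ≤ W :=
  (tsum_nonneg fun x => mul_nonneg (sq_nonneg _) (h.nonneg x)).trans h.tsumW_le

/-- A single value is at most the mass. [folklore] -/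
theorem apply_le (h : MomentBound g L W) (x : Site d) : g x ≤ L :=
  (h.summable.le_tsum x fun y _ => h.nonneg y).trans h.tsum_le

/-- [folklore] -/
theorem summable_abs (h : MomentBound g L W) : Summable fun x => |g x| := h.summable.abs

/-- Weakening the constants. [folklore] -/
theorem mono (h : MomentBound g L W) (hL : L ≤ L') (hW : W ≤ W') : MomentBound g L' W' :=
  ⟨h.nonneg, h.summable, h.tsum_le.trans hL, h.summableW, h.tsumW_le.trans hW⟩

/-- Domination: `0 ≤ f ≤ g`. [folklore] -/
theorem of_le (h : MomentBound g L W) (hf0 : ∀ x, 0 ≤ f x) (hle : ∀ x, f x ≤ g x) : MomentBound f L W where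
  nonneg := hf0
  summable := Summable.of_nonneg_of_le hf0 hle h.summable
  tsum_le := ((Summable.of_nonneg_of_le hf0 hle h.summable).tsum_le_tsum hle h.summable).trans h.tsum_le
  summableW := Summable.of_nonneg_of_le (fun x => mul_nonneg (sq_nonneg _) (hf0 x))
    (fun x => mul_le_mul_of_nonneg_left (hle x) (sq_nonneg _)) h.summableW
  tsumW_le := ((Summable.of_nonneg_of_le (fun x => mul_nonneg (sq_nonneg _) (hf0 x))
    (fun x => mul_le_mul_of_nonneg_left (hle x) (sq_nonneg _)) h.summableW).tsum_le_tsum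
    (fun x => mul_le_mul_of_nonneg_left (hle x) (sq_nonneg _)) h.summableW).trans h.tsumW_le

/-- The zero function. [folklore] -/
theorem zero : MomentBound (fun _ : Site d => (0 : ℝ)) 0 0 where
  nonneg := fun _ => le_rfl
  summable := summable_zero
  tsum_le := by simp
  summableW := by simp [summable_zero]
  tsumW_le := by simp

/-- Sums. [folklore] -/
theorem add (h₁ : MomentBound f L₁ W₁) (h₂ : MomentBound g L₂ W₂) :
    MomentBound (fun x => f x + g x) (L₁ + L₂) (W₁ + W₂) where
  nonneg := fun x => add_nonneg (h₁.nonneg x) (h₂.nonneg x)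
  summable := h₁.summable.add h₂.summable
  tsum_le := by rw [h₁.summable.tsum_add h₂.summable]; exact add_le_add h₁.tsum_le h₂.tsum_le
  summableW := by simpa [mul_add] using h₁.summableW.add h₂.summableW
  tsumW_le := by
    simp only [mul_add]
    rw [h₁.summableW.tsum_add h₂.summableW]; exact add_le_add h₁.tsumW_le h₂.tsumW_le

/-- Non-negative multiples. [folklore] -/
theorem const_mul (h : MomentBound g L W) {c : ℝ} (hc : 0 ≤ c) :
    MomentBound (fun x => c * g x) (c * L) (c * W) where
  nonneg := fun x => mul_nonneg hc (h.nonneg x)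
  summable := h.summable.mul_left c
  tsum_le := by rw [tsum_mul_left]; exact mul_le_mul_of_nonneg_left h.tsum_le hc
  summableW := by simpa [mul_left_comm] using h.summableW.mul_left c
  tsumW_le := by
    simp only [mul_left_comm _ c]
    rw [tsum_mul_left]; exact mul_le_mul_of_nonneg_left h.tsumW_le hc

/-- Finite sums. [folklore] -/
theorem finset_sum {α : Type*} (s : Finset α) {F : α → Site d → ℝ} {Ls Ws : α → ℝ}
    (h : ∀ a ∈ s, MomentBound (F a) (Ls a) (Ws a)) :
    MomentBound (fun x => ∑ a ∈ s, F a x) (∑ a ∈ s, Ls a) (∑ a ∈ s, Ws a) := by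
  classical
  induction s using Finset.induction_on with
  | empty => simpa using (zero : MomentBound (fun _ : Site d => (0 : ℝ)) 0 0)
  | @insert a s ha ih =>
    have h1 := (h a (Finset.mem_insert_self a s)).add (ih fun b hb => h b (Finset.mem_insert_of_mem hb))
    simpa [Finset.sum_insert ha] using h1

/-- Direction sums with a uniform bound: `Σ_κ F_κ` has mass `≤ 2dL` and displacement `≤ 2dW`. [folklore] -/
theorem sum_dir {F : Fin d × Bool → Site d → ℝ} (h : ∀ κ, MomentBound (F κ) L W) :
    MomentBound (fun x => ∑ κ : Fin d × Bool, F κ x) (2 * d * L) (2 * d * W) := by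
  have h1 := finset_sum Finset.univ (fun κ (_ : κ ∈ (Finset.univ : Finset (Fin d × Bool))) => h κ)
  rwa [sum_const_dir, sum_const_dir] at h1

/-- A shift keeps the mass and at most doubles-plus the displacement:
`Σ ‖·‖₂² g(·+v) ≤ 2W + 2‖v‖₂² L`. [cite: FitznerVanDerHofstad2016NoBLE, (2.24) (p. 1063)] -/
theorem comp_add (h : MomentBound g L W) (v : Site d) :
    MomentBound (fun x => g (x + v)) L (2 * W + 2 * euclidNorm v ^ 2 * L) where
  nonneg := fun x => h.nonneg _
  summable := (summable_comp_add_right_iff v).2 h.summable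
  tsum_le := by rw [tsum_comp_add_right']; exact h.tsum_le
  summableW := summable_sq_mul_comp_add_right h.nonneg h.summable h.summableW v
  tsumW_le := by
    rw [tsum_sq_mul_comp_add_right]
    refine (tsum_sq_sub_mul_le h.nonneg h.summable h.summableW v).trans ?_
    have := h.L_nonneg
    nlinarith [h.tsum_le, h.tsumW_le, sq_nonneg (euclidNorm v)]

/-- **The shifted direction sum** `x ↦ Σ_κ g(x + e_κ)` has mass `2d Σ g` and displacement `2d(Σ ‖·‖₂² g + Σ g)`
((D.28): every displacement constant of a shifted coefficient comes with its mass companion).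
[cite: FitznerVanDerHofstad2016NoBLE, App. D (D.28) (p. 1116)] -/
theorem sum_dir_comp_add_stepVec (h : MomentBound g L W) :
    MomentBound (fun x => ∑ κ : Fin d × Bool, g (x + 𝐞 κ)) (2 * d * L) (2 * d * (W + L)) where
  nonneg := fun x => Finset.sum_nonneg fun κ _ => h.nonneg _
  summable := summable_sum fun κ _ => (summable_comp_add_right_iff (𝐞 κ)).2 h.summable
  tsum_le := by
    rw [Summable.tsum_finsetSum fun κ _ => (summable_comp_add_right_iff (𝐞 κ)).2 h.summable]
    simp only [tsum_comp_add_right']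
    rw [sum_const_dir]
    have hd : (0 : ℝ) ≤ 2 * d := by positivity
    exact mul_le_mul_of_nonneg_left h.tsum_le hd
  summableW := by
    simp only [Finset.mul_sum]
    exact summable_sum fun κ _ => summable_sq_mul_comp_add_right h.nonneg h.summable h.summableW (𝐞 κ)
  tsumW_le := by
    simp only [Finset.mul_sum]
    rw [Summable.tsum_finsetSum fun κ _ => summable_sq_mul_comp_add_right h.nonneg h.summable h.summableW (𝐞 κ),
      sum_dir_tsum_sq_mul_comp_add_stepVec h.nonneg h.summable h.summableW]
    have hd : (0 : ℝ) ≤ 2 * d := by positivity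
    exact mul_le_mul_of_nonneg_left (add_le_add h.tsumW_le h.tsum_le) hd

/-- **Convolution with an even factor**: mass `≤ L₁L₂`, displacement `≤ W₁L₂ + L₁W₂` ((D.25)–(D.27)).
[cite: FitznerVanDerHofstad2016NoBLE, App. D (D.25)–(D.28) (p. 1116)] -/
theorem lconv (hf : MomentBound f L₁ W₁) (hfe : ∀ x, f (-x) = f x) (hg : MomentBound g L₂ W₂) :
    MomentBound (lconv f g) (L₁ * L₂) (W₁ * L₂ + L₁ * W₂) where
  nonneg := lconv_nonneg hf.nonneg hg.nonneg
  summable := summable_lconv hf.summable_abs hg.summable_abs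
  tsum_le := by
    rw [tsum_lconv hf.summable_abs hg.summable_abs]
    exact mul_le_mul hf.tsum_le hg.tsum_le (tsum_nonneg hg.nonneg) hf.L_nonneg
  summableW := summable_sq_mul_lconv hf.nonneg hg.nonneg hf.summable hg.summable hf.summableW hg.summableW
  tsumW_le := by
    rw [tsum_sq_mul_lconv hf.nonneg hg.nonneg hf.summable hg.summable hf.summableW hg.summableW hfe]
    have h1 : (∑' x, euclidNorm x ^ 2 * f x) * (∑' x, g x) ≤ W₁ * L₂ :=
      mul_le_mul hf.tsumW_le hg.tsum_le (tsum_nonneg hg.nonneg) hf.W_nonneg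
    have h2 : (∑' x, f x) * (∑' x, euclidNorm x ^ 2 * g x) ≤ L₁ * W₂ :=
      mul_le_mul hf.tsum_le hg.tsumW_le (tsum_nonneg fun x => mul_nonneg (sq_nonneg _) (hg.nonneg x)) hf.L_nonneg
    exact add_le_add h1 h2

/-- **Series**: `x ↦ Σ_n F_n(x)` with `Σ_n L_n`, `Σ_n W_n` (Tonelli). [folklore] -/
theorem tsum {F : ℕ → Site d → ℝ} {Ls Ws : ℕ → ℝ} (h : ∀ n, MomentBound (F n) (Ls n) (Ws n))
    (hL : Summable Ls) (hW : Summable Ws) :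
    MomentBound (fun x => ∑' n, F n x) (∑' n, Ls n) (∑' n, Ws n) := by
  have h0 : ∀ n x, 0 ≤ F n x := fun n x => (h n).nonneg x
  have h0W : ∀ n x, 0 ≤ euclidNorm x ^ 2 * F n x := fun n x => mul_nonneg (sq_nonneg _) (h0 n x)
  have hrow : Summable fun n => ∑' x, F n x :=
    Summable.of_nonneg_of_le (fun n => tsum_nonneg (h0 n)) (fun n => (h n).tsum_le) hL
  have hrowW : Summable fun n => ∑' x, euclidNorm x ^ 2 * F n x :=
    Summable.of_nonneg_of_le (fun n => tsum_nonneg (h0W n)) (fun n => (h n).tsumW_le) hW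
  obtain ⟨hpt, hsum⟩ := summable_swap_of_nonneg h0 (fun n => (h n).summable) hrow
  obtain ⟨hptW, hsumW⟩ := summable_swap_of_nonneg h0W (fun n => (h n).summableW) hrowW
  have hprod : Summable (Function.uncurry F) :=
    (summable_prod_of_nonneg fun q => h0 q.1 q.2).2 ⟨fun n => (h n).summable, hrow⟩
  have hprodW : Summable (Function.uncurry fun n x => euclidNorm x ^ 2 * F n x) :=
    (summable_prod_of_nonneg fun q => h0W q.1 q.2).2 ⟨fun n => (h n).summableW, hrowW⟩
  have hmul : ∀ x, euclidNorm x ^ 2 * ∑' n, F n x = ∑' n, euclidNorm x ^ 2 * F n x :=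
    fun x => tsum_mul_left.symm
  refine ⟨fun x => tsum_nonneg fun n => h0 n x, hsum, ?_, ?_, ?_⟩
  · rw [hprod.tsum_comm]
    exact hrow.tsum_le_tsum (fun n => (h n).tsum_le) hL
  · simp only [hmul]; exact hsumW
  · simp only [hmul]
    rw [hprodW.tsum_comm]
    exact hrowW.tsum_le_tsum (fun n => (h n).tsumW_le) hW

end MomentBound

/-! ### Moment bounds from the `SumLE` / `NSumLE` data of Assumption 4.3 -/

/-- `NSumLE` is shift-invariant in `x`. [folklore] -/
theorem NSumLE.comp_add_right {F : ℕ → Site d → ℝ} {β : ℝ} (h : NSumLE F β) (v : Site d) :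
    NSumLE (fun N x => F N (x + v)) β := by
  obtain ⟨h1, h2, h3⟩ := h
  refine ⟨fun N => (summable_comp_add_right_iff v).2 (h1 N), ?_, ?_⟩
  · simp only [tsum_comp_add_right']; exact h2
  · simp only [tsum_comp_add_right']; exact h3

/-- A class function `x ↦ Σ_N F_N(x)` with `NSumLE` mass and displacement data has the bundled moment bound.
[cite: FitznerVanDerHofstad2016NoBLE, Assumption 4.3 (4.31)–(4.32), (4.49) (pp. 1086–1088)] -/
theorem momentBound_of_NSumLE {F : ℕ → Site d → ℝ} (h0 : ∀ N x, 0 ≤ F N x) {β β' : ℝ} (hL : NSumLE F β)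
    (hW : NSumLE (fun N x => euclidNorm x ^ 2 * F N x) β') :
    MomentBound (fun x => ∑' N, F N x) β β' := by
  obtain ⟨-, hs, -, hle⟩ := l1_of_NSumLE h0 hL
  obtain ⟨-, hsW, -, hleW⟩ := l1_of_NSumLE (fun N x => mul_nonneg (sq_nonneg _) (h0 N x)) hW
  have hmul : ∀ x, euclidNorm x ^ 2 * ∑' N, F N x = ∑' N, euclidNorm x ^ 2 * F N x :=
    fun x => tsum_mul_left.symm
  refine ⟨fun x => tsum_nonneg fun N => h0 N x, hs, hle, ?_, ?_⟩
  · simp only [hmul]; exact hsW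
  · simp only [hmul]; exact hleW

/-- The shifted class function `x ↦ Σ_N F_N(x + v)` with displacement data ABOUT `v`
(`Σ_N Σ_x ‖x − v‖₂² F_N(x) ≤ β'`, the shape of (4.33)). [cite: FitznerVanDerHofstad2016NoBLE, Assumption 4.3 (4.33), (4.49) (pp. 1086–1088)] -/
theorem momentBound_of_NSumLE_shift {F : ℕ → Site d → ℝ} (h0 : ∀ N x, 0 ≤ F N x) {β β' : ℝ}
    (hL : NSumLE F β) (v : Site d) (hW : NSumLE (fun N x => euclidNorm (x - v) ^ 2 * F N x) β') :
    MomentBound (fun x => ∑' N, F N (x + v)) β β' := by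
  have hW' : NSumLE (fun N x => euclidNorm x ^ 2 * F N (x + v)) β' := by
    have := hW.comp_add_right v
    simpa [add_sub_cancel_right] using this
  exact momentBound_of_NSumLE (fun N x => h0 N _) (hL.comp_add_right v) hW'

/-- A single function with `SumLE` mass and displacement data. [cite: FitznerVanDerHofstad2016NoBLE, Assumption 4.3 (4.43)–(4.48) (pp. 1087–1088)] -/
theorem momentBound_of_SumLE {g : Site d → ℝ} (h0 : ∀ x, 0 ≤ g x) {β β' : ℝ} (hL : SumLE g β)
    (hW : SumLE (fun x => euclidNorm x ^ 2 * g x) β') : MomentBound g β β' :=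
  ⟨h0, hL.1, hL.2, hW.1, hW.2⟩

/-- A single shifted function `x ↦ g(x + v)` with displacement data about `v`. [cite: FitznerVanDerHofstad2016NoBLE, Assumption 4.3 (4.44), (4.46) (p. 1087)] -/
theorem momentBound_of_SumLE_shift {g : Site d → ℝ} (h0 : ∀ x, 0 ≤ g x) {β β' : ℝ} (hL : SumLE g β)
    (v : Site d) (hW : SumLE (fun x => euclidNorm (x - v) ^ 2 * g x) β') :
    MomentBound (fun x => g (x + v)) β β' := by
  refine ⟨fun x => h0 _, (summable_comp_add_right_iff v).2 hL.1, ?_, ?_, ?_⟩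
  · rw [tsum_comp_add_right']; exact hL.2
  · exact (summable_sq_mul_comp_add_right_iff v).2 hW.1
  · rw [tsum_sq_mul_comp_add_right]; exact hW.2

end Moments

/-! ### Linearity of `lconv` and the scalar majorant of the matrix iterates ((D.6)–(D.8), (D.29))

[NoBLE17] App. D Step 2 bounds the `n`-fold kernel products `(A^n u)_ι` by powers of the row-sum ratio
`2dμ̄β^abs_{Ξ^ι}/(1−μ)` ((D.6)–(D.8)); Step 4 ((D.29)) does the same for the displacement.  We phrase both as
ONE scalar majorant iteration `T_0 := t_0 ≥ Σ_κ |u_κ|`, `T_{n+1} := B ⋆ T_n` with `B := Σ_ι b_ι`,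
`|A^{ι,κ}| ≤ b_ι` (a `κ`-independent majorant), and its bundled moment bounds. -/

section Iterates

variable {I : Type*} [Fintype I]

omit [Fintype I] in
/-- `f ⋆ g(· + v) = (f ⋆ g)(· + v)`. [folklore] -/
theorem lconv_comp_add (f g : Site d → ℝ) (v x : Site d) :
    lconv f (fun y => g (y + v)) x = lconv f g (x + v) := by
  unfold lconv
  exact tsum_congr fun y => by rw [add_sub_right_comm]

omit [Fintype I] in
/-- `y ↦ f(y) g(x − y)` is summable for `f ∈ ℓ¹` and bounded `g`. [folklore] -/
theorem summable_mul_shift_of_abs_le {f g : Site d → ℝ} (hf : Summable fun y => |f y|) {C : ℝ}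
    (hg : ∀ y, |g y| ≤ C) (x : Site d) : Summable fun y => f y * g (x - y) :=
  Summable.of_norm_bounded (hf.mul_right C) fun y => by
    rw [Real.norm_eq_abs, abs_mul]; exact mul_le_mul_of_nonneg_left (hg _) (abs_nonneg _)

omit [Fintype I] in
/-- A non-negative summable function is bounded by its mass. [folklore] -/
theorem abs_le_tsum_of_nonneg {g : Site d → ℝ} (hg0 : ∀ y, 0 ≤ g y) (hg : Summable g) (y : Site d) :
    |g y| ≤ ∑' z, g z := by
  rw [abs_of_nonneg (hg0 y)]; exact hg.le_tsum y fun z _ => hg0 z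

omit [Fintype I] in
/-- Right-linearity of `lconv` over finite sums. [folklore] -/
theorem lconv_finset_sum_right {α : Type*} (s : Finset α) (f : Site d → ℝ) (g : α → Site d → ℝ) (x : Site d)
    (h : ∀ a ∈ s, Summable fun y => f y * g a (x - y)) :
    lconv f (fun y => ∑ a ∈ s, g a y) x = ∑ a ∈ s, lconv f (g a) x := by
  unfold lconv
  simp only [Finset.mul_sum]
  exact Summable.tsum_finsetSum h

omit [Fintype I] in
/-- Left-linearity of `lconv` over finite sums. [folklore] -/
theorem lconv_finset_sum_left {α : Type*} (s : Finset α) (f : α → Site d → ℝ) (g : Site d → ℝ) (x : Site d)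
    (h : ∀ a ∈ s, Summable fun y => f a y * g (x - y)) :
    lconv (fun y => ∑ a ∈ s, f a y) g x = ∑ a ∈ s, lconv (f a) g x := by
  unfold lconv
  simp only [Finset.sum_mul]
  exact Summable.tsum_finsetSum h

omit [Fintype I] in
/-- `(c f) ⋆ g = c (f ⋆ g)`. [folklore] -/
theorem lconv_const_mul_left (c : ℝ) (f g : Site d → ℝ) (x : Site d) :
    lconv (fun y => c * f y) g x = c * lconv f g x := by
  unfold lconv
  simp only [mul_assoc]
  exact tsum_mul_left

omit [Fintype I] in
/-- `f ⋆ (c g) = c (f ⋆ g)`. [folklore] -/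
theorem lconv_const_mul_right (c : ℝ) (f g : Site d → ℝ) (x : Site d) :
    lconv f (fun y => c * g y) x = c * lconv f g x := by
  unfold lconv
  simp only [mul_left_comm _ c]
  exact tsum_mul_left

omit [Fintype I] in
/-- `f ⋆ (g + h) = f⋆g + f⋆h`. [folklore] -/
theorem lconv_add_right {f g h : Site d → ℝ} {x : Site d} (hg : Summable fun y => f y * g (x - y))
    (hh : Summable fun y => f y * h (x - y)) :
    lconv f (fun y => g y + h y) x = lconv f g x + lconv f h x := by
  unfold lconv
  simp only [mul_add]
  exact hg.tsum_add hh

omit [Fintype I] in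
/-- `f ⋆ (g − h) = f⋆g − f⋆h`. [folklore] -/
theorem lconv_sub_right {f g h : Site d → ℝ} {x : Site d} (hg : Summable fun y => f y * g (x - y))
    (hh : Summable fun y => f y * h (x - y)) :
    lconv f (fun y => g y - h y) x = lconv f g x - lconv f h x := by
  unfold lconv
  simp only [mul_sub]
  exact hg.tsum_sub hh

omit [Fintype I] in
/-- `(f + g) ⋆ h = f⋆h + g⋆h`. [folklore] -/
theorem lconv_add_left {f g h : Site d → ℝ} {x : Site d} (hf : Summable fun y => f y * h (x - y))
    (hg : Summable fun y => g y * h (x - y)) :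
    lconv (fun y => f y + g y) h x = lconv f h x + lconv g h x := by
  unfold lconv
  simp only [add_mul]
  exact hf.tsum_add hg

omit [Fintype I] in
/-- `(f − g) ⋆ h = f⋆h − g⋆h`. [folklore] -/
theorem lconv_sub_left {f g h : Site d → ℝ} {x : Site d} (hf : Summable fun y => f y * h (x - y))
    (hg : Summable fun y => g y * h (x - y)) :
    lconv (fun y => f y - g y) h x = lconv f h x - lconv g h x := by
  unfold lconv
  simp only [sub_mul]
  exact hf.tsum_sub hg

omit [Fintype I] in
/-- `f ⋆ (−g) = −(f⋆g)`. [folklore] -/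
theorem lconv_neg_right (f g : Site d → ℝ) (x : Site d) : lconv f (fun y => -g y) x = -lconv f g x := by
  unfold lconv
  simp only [mul_neg]
  exact tsum_neg

omit [Fintype I] in
/-- `(−f) ⋆ g = −(f⋆g)`. [folklore] -/
theorem lconv_neg_left (f g : Site d → ℝ) (x : Site d) : lconv (fun y => -f y) g x = -lconv f g x := by
  unfold lconv
  simp only [neg_mul]
  exact tsum_neg

omit [Fintype I] in
/-- **The scalar majorant iteration** `T_0 := t_0`, `T_{n+1} := B ⋆ T_n`.
[cite: FitznerVanDerHofstad2016NoBLE, App. D (D.6)–(D.8) (pp. 1111–1112) and (D.29) (p. 1116)] -/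
def titer (B t0 : Site d → ℝ) : ℕ → Site d → ℝ
  | 0 => t0
  | n + 1 => lconv B (titer B t0 n)

omit [Fintype I] in
/-- [folklore] -/
@[simp] theorem titer_zero (B t0 : Site d → ℝ) : titer B t0 0 = t0 := rfl

omit [Fintype I] in
/-- [folklore] -/
theorem titer_succ (B t0 : Site d → ℝ) (n : ℕ) : titer B t0 (n + 1) = lconv B (titer B t0 n) := rfl

omit [Fintype I] in
/-- The displacement constants of the iteration: `W_0 := w_0`, `W_{n+1} := W_B t^n a_0 + t W_n`. [folklore] -/
def titerW (t WB a0 w0 : ℝ) : ℕ → ℝ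
  | 0 => w0
  | n + 1 => WB * (t ^ n * a0) + t * titerW t WB a0 w0 n

omit [Fintype I] in
/-- Closed form: `W_{n+1} = (n+1) t^n W_B a_0 + t^{n+1} w_0` ((D.29): "`Σ_{n≥2} n ρ^{n−1}`").
[cite: FitznerVanDerHofstad2016NoBLE, App. D (D.29) (p. 1116)] -/
theorem titerW_succ_eq (t WB a0 w0 : ℝ) :
    ∀ n : ℕ, titerW t WB a0 w0 (n + 1) = (n + 1) * t ^ n * (WB * a0) + t ^ (n + 1) * w0
  | 0 => by simp [titerW]
  | n + 1 => by
    rw [titerW, titerW_succ_eq t WB a0 w0 n]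
    push_cast
    ring

omit [Fintype I] in
/-- **Moment bounds of the iterates**: mass `≤ t^n a_0`, displacement `≤ W_n`, when `B` is even with mass `≤ t`
and displacement `≤ W_B` and `T_0` has mass `≤ a_0`, displacement `≤ w_0`.
[cite: FitznerVanDerHofstad2016NoBLE, App. D (D.6)–(D.8), (D.25)–(D.29) (pp. 1111–1116)] -/
theorem momentBound_titer {B t0 : Site d → ℝ} {t WB a0 w0 : ℝ} (hB : MomentBound B t WB)
    (hBe : ∀ x, B (-x) = B x) (h0 : MomentBound t0 a0 w0) :
    ∀ n, MomentBound (titer B t0 n) (t ^ n * a0) (titerW t WB a0 w0 n)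
  | 0 => by simpa [titerW] using h0
  | n + 1 => by
    have h := hB.lconv hBe (momentBound_titer hB hBe h0 n)
    rw [titer_succ]
    exact h.mono (le_of_eq (by ring)) (le_of_eq (by rw [titerW]))

omit [Fintype I] in
/-- `Σ_n t^{n+2} a_0 = a_0 t²/(1−t)`. [folklore] -/
theorem tsum_pow_add_two_mul {t : ℝ} (ht0 : 0 ≤ t) (ht1 : t < 1) (a0 : ℝ) :
    (Summable fun n : ℕ => t ^ (n + 2) * a0) ∧ ∑' n : ℕ, t ^ (n + 2) * a0 = a0 * t ^ 2 / (1 - t) := by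
  have hg := summable_geometric_of_lt_one ht0 ht1
  have e : (fun n : ℕ => t ^ (n + 2) * a0) = fun n => t ^ n * (t ^ 2 * a0) := by
    funext n; ring
  rw [e]
  refine ⟨hg.mul_right _, ?_⟩
  rw [tsum_mul_right, tsum_geometric_of_lt_one ht0 ht1]
  field_simp

omit [Fintype I] in
/-- `Σ_n [(n+2) t^{n+1} c + t^{n+2} w_0] = c (t/(1−t)² + t/(1−t)) + w_0 t · t/(1−t)`. [folklore] -/
theorem tsum_titerW_tail {t : ℝ} (ht0 : 0 ≤ t) (ht1 : t < 1) (c w0 : ℝ) :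
    (Summable fun n : ℕ => ((n : ℝ) + 2) * t ^ (n + 1) * c + t ^ (n + 2) * w0) ∧
      ∑' n : ℕ, (((n : ℝ) + 2) * t ^ (n + 1) * c + t ^ (n + 2) * w0) =
        c * (t / (1 - t) ^ 2 + t / (1 - t)) + w0 * t * (t / (1 - t)) := by
  have htn : ‖t‖ < 1 := by rw [Real.norm_eq_abs, abs_of_nonneg ht0]; exact ht1
  have hg := summable_geometric_of_lt_one ht0 ht1
  have hng : Summable fun n : ℕ => (n : ℝ) * t ^ n := by
    simpa using summable_pow_mul_geometric_of_norm_lt_one 1 htn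
  have e : (fun n : ℕ => ((n : ℝ) + 2) * t ^ (n + 1) * c + t ^ (n + 2) * w0) =
      fun n : ℕ => (n : ℝ) * t ^ n * (t * c) + t ^ n * (2 * t * c + t ^ 2 * w0) := by
    funext n; ring
  rw [e]
  refine ⟨(hng.mul_right _).add (hg.mul_right _), ?_⟩
  rw [(hng.mul_right _).tsum_add (hg.mul_right _), tsum_mul_right, tsum_mul_right,
    tsum_coe_mul_geometric_of_norm_lt_one htn, tsum_geometric_of_lt_one ht0 ht1]
  have h1 : (1 - t) ≠ 0 := by linarith
  field_simp
  ring

omit [Fintype I] in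
/-- **The tail `Σ_{n≥2} T_n`** of the majorant iteration: mass `≤ a_0 t²/(1−t)`, displacement
`≤ W_B a_0 (t/(1−t)² + t/(1−t)) + w_0 t · t/(1−t)` — the geometric sums of (D.29)/(D.32) lines 1–3.
[cite: FitznerVanDerHofstad2016NoBLE, App. D (D.29) (p. 1116), (D.32) lines 1–3 (p. 1117)] -/
theorem momentBound_titer_tail {B t0 : Site d → ℝ} {t WB a0 w0 : ℝ} (hB : MomentBound B t WB)
    (hBe : ∀ x, B (-x) = B x) (h0 : MomentBound t0 a0 w0) (ht1 : t < 1) :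
    MomentBound (fun x => ∑' n, titer B t0 (n + 2) x) (a0 * t ^ 2 / (1 - t))
      (WB * a0 * (t / (1 - t) ^ 2 + t / (1 - t)) + w0 * t * (t / (1 - t))) := by
  have ht0 : 0 ≤ t := hB.L_nonneg
  have hn : ∀ n, MomentBound (titer B t0 (n + 2)) (t ^ (n + 2) * a0)
      (((n : ℝ) + 2) * t ^ (n + 1) * (WB * a0) + t ^ (n + 2) * w0) := fun n => by
    have h := momentBound_titer hB hBe h0 (n + 2)
    rw [titerW_succ_eq] at h
    refine h.mono le_rfl (le_of_eq ?_)
    push_cast; ring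
  obtain ⟨hsL, heL⟩ := tsum_pow_add_two_mul ht0 ht1 a0
  obtain ⟨hsW, heW⟩ := tsum_titerW_tail ht0 ht1 (WB * a0) w0
  have h := MomentBound.tsum hn hsL hsW
  rw [heL, heW] at h
  refine h.mono le_rfl (le_of_eq (by ring))

/-- **The matrix iterates are dominated by the scalar iteration**: if `|A^{ι,κ}| ≤ b_ι` (`κ`-independent,
`b_ι ≥ 0` summable) and `Σ_ι |u_ι| ≤ T_0`, then `Σ_ι |(A^n u)_ι(x)| ≤ T_n(x)` with `B := Σ_ι b_ι`.
[cite: FitznerVanDerHofstad2016NoBLE, App. D (D.6)–(D.8) (pp. 1111–1112), (D.29) (p. 1116)] -/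
theorem sum_abs_kiter_le_titer {A : I → I → Site d → ℝ} {u : I → Site d → ℝ}
    (hA : ∀ ι κ, Summable fun x => |A ι κ x|) (hu : ∀ ι, Summable fun x => |u ι x|)
    {b : I → Site d → ℝ} (hb0 : ∀ ι x, 0 ≤ b ι x) (hbs : ∀ ι, Summable (b ι))
    (hAb : ∀ ι κ x, |A ι κ x| ≤ b ι x) {t0 : Site d → ℝ} (ht0 : ∀ x, ∑ ι, |u ι x| ≤ t0 x)
    (hT0 : ∀ n x, 0 ≤ titer (fun y => ∑ ι, b ι y) t0 n x) (hTs : ∀ n, Summable (titer (fun y => ∑ ι, b ι y) t0 n)) :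
    ∀ n x, ∑ ι, |kiter A u n ι x| ≤ titer (fun y => ∑ ι, b ι y) t0 n x := by
  classical
  -- ℓ¹ of the iterates (for the linearity steps)
  have hθ : ∀ ι, ∑ κ, ∑' x, |A ι κ x| ≤ ∑ ι, ∑ κ, ∑' x, |A ι κ x| := fun ι =>
    Finset.single_le_sum (f := fun ι => ∑ κ, ∑' x, |A ι κ x|)
      (fun ι _ => Finset.sum_nonneg fun κ _ => tsum_nonneg fun _ => abs_nonneg _) (Finset.mem_univ ι)
  have hU : ∀ ι, ∑' x, |u ι x| ≤ ∑ ι, ∑' x, |u ι x| := fun ι =>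
    Finset.single_le_sum (f := fun ι => ∑' x, |u ι x|) (fun ι _ => tsum_nonneg fun _ => abs_nonneg _)
      (Finset.mem_univ ι)
  have hl1 : ∀ n κ, Summable fun x => |kiter A u n κ x| := fun n κ => (kiter_l1 hA hu hθ hU n κ).1
  intro n
  induction n with
  | zero => intro x; rw [kiter_zero, titer_zero]; exact ht0 x
  | succ n ih =>
    intro x
    set T := titer (fun y => ∑ ι, b ι y) t0 n with hT
    have hbabs : ∀ ι, Summable fun y => |b ι y| := fun ι => (hbs ι).abs
    -- |Σ_κ A^{ι,κ} ⋆ t_κ| ≤ Σ_κ b_ι ⋆ |t_κ|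
    have h1 : ∀ ι, |kiter A u (n + 1) ι x| ≤ ∑ κ, lconv (b ι) (fun y => |kiter A u n κ y|) x := fun ι => by
      rw [kiter_succ]
      show |∑ κ, lconv (A ι κ) (kiter A u n κ) x| ≤ _
      refine (Finset.abs_sum_le_sum_abs _ _).trans (Finset.sum_le_sum fun κ _ => ?_)
      exact abs_lconv_le_lconv (hAb ι κ) (fun y => le_rfl) (hbs ι) (summable_abs_iff.2 (hl1 n κ) |>.congr
        fun y => by simp) x
    -- Σ_κ b_ι ⋆ |t_κ| = b_ι ⋆ (Σ_κ |t_κ|) ≤ b_ι ⋆ T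
    have h2 : ∀ ι, ∑ κ, lconv (b ι) (fun y => |kiter A u n κ y|) x ≤ lconv (b ι) T x := fun ι => by
      rw [← lconv_finset_sum_right Finset.univ (b ι) (fun κ y => |kiter A u n κ y|) x fun κ _ =>
        summable_mul_shift_of_abs_le (hbabs ι)
          (fun y => (abs_abs (kiter A u n κ y)).le.trans
            ((hl1 n κ).le_tsum y fun z _ => abs_nonneg _)) x]
      exact lconv_mono (hb0 ι) (fun y => le_rfl) (fun y => Finset.sum_nonneg fun κ _ => abs_nonneg _)
        (ih) (hbs ι) (hTs n) x
    -- Σ_ι b_ι ⋆ T = B ⋆ T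
    have h3 : ∑ ι, lconv (b ι) T x = lconv (fun y => ∑ ι, b ι y) T x :=
      (lconv_finset_sum_left Finset.univ b T x fun ι _ =>
        summable_mul_shift_of_abs_le (hbabs ι) (abs_le_tsum_of_nonneg (hT0 n) (hTs n)) x).symm
    calc ∑ ι, |kiter A u (n + 1) ι x| ≤ ∑ ι, ∑ κ, lconv (b ι) (fun y => |kiter A u n κ y|) x :=
          Finset.sum_le_sum fun ι _ => h1 ι
      _ ≤ ∑ ι, lconv (b ι) T x := Finset.sum_le_sum fun ι _ => h2 ι
      _ = titer (fun y => ∑ ι, b ι y) t0 (n + 1) x := by rw [h3, titer_succ]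

end Iterates

/-! ### The parity classes `Σ_N Ξ^{(M_N)}`, `Σ_N Ψ^{(M_N),κ}`, `Σ_N Ξ^{(M_N),ι}`, `Σ_N Π^{(M_N),ι,κ}` -/

section Classes

local notation "𝐞" => Literature.Probability.Percolation.stepVec

/-- `Ξ^{[M]}_p(y) := Σ_N Ξ^{(M_N)}_p(y)` — a parity class of the coefficients (`M_N = N, 2N, 2N+1, 2N+2, 2N+3`
for the classes `abs, even, odd, even ≥ 2, odd ≥ 3` of (D.32)). [cite: FitznerVanDerHofstad2016NoBLE, Assumption 4.3 (4.49) and App. D Step 5 (p. 1117)] -/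
def nobleXiCls (d : ℕ) (p : unitInterval) (M : ℕ → ℕ) (y : Site d) : ℝ := ∑' N, nobleXiN d p (M N) y

/-- `Ψ^{[M],e}_p(y) := Σ_N Ψ^{(M_N),e}_p(y)`. [cite: FitznerVanDerHofstad2016NoBLE, Assumption 4.3 (4.49) and App. D Step 5 (p. 1117)] -/
def noblePsiCls (d : ℕ) (p : unitInterval) (M : ℕ → ℕ) (e y : Site d) : ℝ := ∑' N, noblePsiN d p e (M N) y

/-- `Ξ^{[M],e}_p(y) := Σ_N Ξ^{(M_N),e}_p(y)` (direction classes). [cite: FitznerVanDerHofstad2016NoBLE, Assumption 4.3 (4.49) and App. D Step 5 (p. 1117)] -/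
def nobleXiIotaCls (d : ℕ) (p : unitInterval) (M : ℕ → ℕ) (e y : Site d) : ℝ := ∑' N, nobleXiIotaN d p e (M N) y

/-- `Π^{[M],e,e'}_p(y) := Σ_N Π^{(M_N),e,e'}_p(y)`. [cite: FitznerVanDerHofstad2016NoBLE, Assumption 4.3 (4.49) and App. D Step 5 (p. 1117)] -/
def noblePiCls (d : ℕ) (p : unitInterval) (M : ℕ → ℕ) (e e' y : Site d) : ℝ := ∑' N, noblePiN d p e e' (M N) y

variable {p : unitInterval} {i : BetaMap.Inputs} {S : NobleSplit d p}

/-- [folklore] -/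
theorem nobleXiCls_nonneg (M : ℕ → ℕ) (y : Site d) : 0 ≤ nobleXiCls d p M y :=
  tsum_nonneg fun _ => nobleXiN_nonneg p _ y

/-- [folklore] -/
theorem noblePsiCls_nonneg (M : ℕ → ℕ) (e y : Site d) : 0 ≤ noblePsiCls d p M e y :=
  tsum_nonneg fun _ => noblePsiN_nonneg' p e _ y

/-- [folklore] -/
theorem nobleXiIotaCls_nonneg (M : ℕ → ℕ) (e y : Site d) : 0 ≤ nobleXiIotaCls d p M e y :=
  tsum_nonneg fun _ => nobleXiIotaN_nonneg p e _ y

/-- [folklore] -/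
theorem noblePiCls_nonneg (M : ℕ → ℕ) (e e' y : Site d) : 0 ≤ noblePiCls d p M e e' y :=
  tsum_nonneg fun _ => noblePiN_nonneg p e e' _ y

/-- Transport of the classes under signed permutations ([FvdH17] §3.5). [cite: FitznerVanDerHofstad2017, §3.5 (Symmetry of the model)] -/
theorem nobleXiCls_relabel (π : Equiv.Perm (Fin d)) (ε : Fin d → ℤˣ) (M : ℕ → ℕ) (y : Site d) :
    nobleXiCls d p M (zdSignedPermIso π ε y) = nobleXiCls d p M y :=
  tsum_congr fun N => nobleXiN_relabel _ (zdSignedPermIso_sub π ε) p (M N) y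

/-- [cite: FitznerVanDerHofstad2017, §3.5 (Symmetry of the model)] -/
theorem nobleXiIotaCls_relabel (π : Equiv.Perm (Fin d)) (ε : Fin d → ℤˣ) (M : ℕ → ℕ) (e y : Site d) :
    nobleXiIotaCls d p M (zdSignedPermIso π ε e) (zdSignedPermIso π ε y) = nobleXiIotaCls d p M e y :=
  tsum_congr fun N => nobleXiIotaN_relabel _ (zdSignedPermIso_sub π ε) p e (M N) y

/-- [cite: FitznerVanDerHofstad2017, §3.5 (Symmetry of the model)] -/
theorem noblePsiCls_relabel (π : Equiv.Perm (Fin d)) (ε : Fin d → ℤˣ) (M : ℕ → ℕ) (e y : Site d) :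
    noblePsiCls d p M (zdSignedPermIso π ε e) (zdSignedPermIso π ε y) = noblePsiCls d p M e y :=
  tsum_congr fun N => noblePsiN_relabel _ (zdSignedPermIso_sub π ε) p e (M N) y

/-- [cite: FitznerVanDerHofstad2017, §3.5 (Symmetry of the model)] -/
theorem noblePiCls_relabel (π : Equiv.Perm (Fin d)) (ε : Fin d → ℤˣ) (M : ℕ → ℕ) (e e' y : Site d) :
    noblePiCls d p M (zdSignedPermIso π ε e) (zdSignedPermIso π ε e') (zdSignedPermIso π ε y) =
      noblePiCls d p M e e' y :=
  tsum_congr fun N => noblePiN_relabel _ (zdSignedPermIso_sub π ε) p e e' (M N) y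

/-- `Ξ^{[M]}` is totally rotationally symmetric. [cite: FitznerVanDerHofstad2017, §3.5 ("x ↦ Ξ^{(N)}_p(x) is TRS for all N ≥ 0")] -/
theorem isTRS_nobleXiCls (M : ℕ → ℕ) : IsTRS (nobleXiCls d p M) :=
  isTRS_of_relabel _ fun π ε y => nobleXiCls_relabel π ε M y

/-- `Ξ^{[M]}` is even. [cite: FitznerVanDerHofstad2017, §3.5] -/
theorem nobleXiCls_neg (M : ℕ → ℕ) (y : Site d) : nobleXiCls d p M (-y) = nobleXiCls d p M y :=
  (isTRS_nobleXiCls M).apply_neg y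

/-! #### The moment bounds of Assumption 4.3 for the classes -/

/-- `Σ_N Ξ^{(N)}`: mass `≤ β^abs_Ξ`, displacement `≤ β^abs_{ΔΞ}`. [cite: FitznerVanDerHofstad2016NoBLE, Assumption 4.3 (4.31)–(4.32), (4.49) (pp. 1086–1088)] -/
theorem momentBound_xiCls_abs (h43 : NobleAssumption43At d p S i) :
    MomentBound (nobleXiCls d p fun N => N) i.xiAbs i.xiDeltaAbs :=
  momentBound_of_NSumLE (fun _ x => nobleXiN_nonneg p _ x) h43.xiAbs h43.xiDeltaAbs

/-- `Σ_N Ξ^{(2N)}`. [cite: FitznerVanDerHofstad2016NoBLE, Assumption 4.3 (4.49) (p. 1088)] -/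
theorem momentBound_xiCls_even (h43 : NobleAssumption43At d p S i) :
    MomentBound (nobleXiCls d p fun N => 2 * N) i.xiEven i.xiEvenDelta :=
  momentBound_of_NSumLE (fun _ x => nobleXiN_nonneg p _ x) h43.xiEven h43.xiEvenDelta

/-- `Σ_N Ξ^{(2N+1)}`. [cite: FitznerVanDerHofstad2016NoBLE, Assumption 4.3 (4.49) (p. 1088)] -/
theorem momentBound_xiCls_odd (h43 : NobleAssumption43At d p S i) :
    MomentBound (nobleXiCls d p fun N => 2 * N + 1) i.xiOdd i.xiOddDelta :=
  momentBound_of_NSumLE (fun _ x => nobleXiN_nonneg p _ x) h43.xiOdd h43.xiOddDelta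

/-- `Σ_{N} Ξ^{(2N+2)}` (even, `N ≥ 1`). [cite: FitznerVanDerHofstad2016NoBLE, Assumption 4.3 (4.49) (p. 1088)] -/
theorem momentBound_xiCls_evenTail (h43 : NobleAssumption43At d p S i) :
    MomentBound (nobleXiCls d p fun N => 2 * N + 2) i.xiEvenTail i.xiEvenTailDelta :=
  momentBound_of_NSumLE (fun _ x => nobleXiN_nonneg p _ x) h43.xiEvenTail h43.xiEvenTailDelta

/-- `Σ_{N} Ξ^{(2N+3)}` (odd, `N ≥ 1`). [cite: FitznerVanDerHofstad2016NoBLE, Assumption 4.3 (4.49) (p. 1088)] -/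
theorem momentBound_xiCls_oddTail (h43 : NobleAssumption43At d p S i) :
    MomentBound (nobleXiCls d p fun N => 2 * N + 3) i.xiOddTail i.xiOddTailDelta :=
  momentBound_of_NSumLE (fun _ x => nobleXiN_nonneg p _ x) h43.xiOddTail h43.xiOddTailDelta

/-- `Σ_N Ξ^{(N),ι}`: mass `≤ β^abs_{Ξ^ι}`, displacement about `0` `≤ β^abs_{ΔΞ^ι,0}`. [cite: FitznerVanDerHofstad2016NoBLE, Assumption 4.3 (4.31)–(4.32), (4.49) (pp. 1086–1088)] -/
theorem momentBound_xiIotaCls_abs (h43 : NobleAssumption43At d p S i) (ι : Fin d × Bool) :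
    MomentBound (nobleXiIotaCls d p (fun N => N) (𝐞 ι)) i.xiIotaAbs i.xiIotaDeltaZero :=
  momentBound_of_NSumLE (fun _ x => nobleXiIotaN_nonneg p _ _ x) (h43.xiIotaAbs ι) (h43.xiIotaDeltaZero ι)

/-- `Σ_N Ξ^{(2N),ι}` about `0`. [cite: FitznerVanDerHofstad2016NoBLE, Assumption 4.3 (4.49) (p. 1088)] -/
theorem momentBound_xiIotaCls_even (h43 : NobleAssumption43At d p S i) (ι : Fin d × Bool) :
    MomentBound (nobleXiIotaCls d p (fun N => 2 * N) (𝐞 ι)) i.xiIotaEven i.xiIotaEvenDeltaZero :=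
  momentBound_of_NSumLE (fun _ x => nobleXiIotaN_nonneg p _ _ x) (h43.xiIotaEven ι) (h43.xiIotaEvenDeltaZero ι)

/-- `Σ_N Ξ^{(2N+1),ι}` about `0`. [cite: FitznerVanDerHofstad2016NoBLE, Assumption 4.3 (4.49) (p. 1088)] -/
theorem momentBound_xiIotaCls_odd (h43 : NobleAssumption43At d p S i) (ι : Fin d × Bool) :
    MomentBound (nobleXiIotaCls d p (fun N => 2 * N + 1) (𝐞 ι)) i.xiIotaOdd i.xiIotaOddDeltaZero :=
  momentBound_of_NSumLE (fun _ x => nobleXiIotaN_nonneg p _ _ x) (h43.xiIotaOdd ι) (h43.xiIotaOddDeltaZero ι)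

/-- `Σ_N Ξ^{(N),ι}(· + e_ι)`: displacement about `e_ι` `≤ β^abs_{ΔΞ^ι,ι}` ((4.33)). [cite: FitznerVanDerHofstad2016NoBLE, Assumption 4.3 (4.33), (4.49) (pp. 1086–1088)] -/
theorem momentBound_xiIotaCls_abs_shift (h43 : NobleAssumption43At d p S i) (ι : Fin d × Bool) :
    MomentBound (fun x => nobleXiIotaCls d p (fun N => N) (𝐞 ι) (x + 𝐞 ι)) i.xiIotaAbs i.xiIotaDeltaEi :=
  momentBound_of_NSumLE_shift (fun _ x => nobleXiIotaN_nonneg p _ _ x) (h43.xiIotaAbs ι) (𝐞 ι)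
    (h43.xiIotaDeltaEi ι)

/-- `Σ_N Ξ^{(2N),ι}(· + e_ι)` about `e_ι`. [cite: FitznerVanDerHofstad2016NoBLE, Assumption 4.3 (4.33), (4.49) (pp. 1086–1088)] -/
theorem momentBound_xiIotaCls_even_shift (h43 : NobleAssumption43At d p S i) (ι : Fin d × Bool) :
    MomentBound (fun x => nobleXiIotaCls d p (fun N => 2 * N) (𝐞 ι) (x + 𝐞 ι)) i.xiIotaEven i.xiIotaEvenDeltaEi :=
  momentBound_of_NSumLE_shift (fun _ x => nobleXiIotaN_nonneg p _ _ x) (h43.xiIotaEven ι) (𝐞 ι)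
    (h43.xiIotaEvenDeltaEi ι)

/-- `Σ_N Ξ^{(2N+1),ι}(· + e_ι)` about `e_ι`. [cite: FitznerVanDerHofstad2016NoBLE, Assumption 4.3 (4.33), (4.49) (pp. 1086–1088)] -/
theorem momentBound_xiIotaCls_odd_shift (h43 : NobleAssumption43At d p S i) (ι : Fin d × Bool) :
    MomentBound (fun x => nobleXiIotaCls d p (fun N => 2 * N + 1) (𝐞 ι) (x + 𝐞 ι)) i.xiIotaOdd i.xiIotaOddDeltaEi :=
  momentBound_of_NSumLE_shift (fun _ x => nobleXiIotaN_nonneg p _ _ x) (h43.xiIotaOdd ι) (𝐞 ι)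
    (h43.xiIotaOddDeltaEi ι)

/-- `Σ_N Ξ^{(2N+2),ι}(· + e_ι)` about `e_ι` (even, `N ≥ 1`). [cite: FitznerVanDerHofstad2016NoBLE, Assumption 4.3 (4.33), (4.49) (pp. 1086–1088)] -/
theorem momentBound_xiIotaCls_evenTail_shift (h43 : NobleAssumption43At d p S i) (ι : Fin d × Bool) :
    MomentBound (fun x => nobleXiIotaCls d p (fun N => 2 * N + 2) (𝐞 ι) (x + 𝐞 ι)) i.xiIotaEvenTail
      i.xiIotaEvenTailDeltaEi :=
  momentBound_of_NSumLE_shift (fun _ x => nobleXiIotaN_nonneg p _ _ x) (h43.xiIotaEvenTail ι) (𝐞 ι)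
    (h43.xiIotaEvenTailDeltaEi ι)

/-! #### Assumption 4.2 on the classes and the parity decompositions -/

variable (hd : 2 ≤ d) (hp : p < criticalProbI d)
include hd hp

/-- `Ψ^{[M],κ} ≤ (μ̄/μ) Ξ^{[M]}` pointwise, and the `N`-series defining `Ψ^{[M],κ}(y)` converges, given an
`NSumLE` bound for `Ξ^{(M_N)}` ((4.29)). [cite: FitznerVanDerHofstad2016NoBLE, Assumption 4.2 (4.29) (p. 1086)] -/
theorem noblePsiCls_le {β : ℝ} {M : ℕ → ℕ} (hΞ : NSumLE (fun N x => nobleXiN d p (M N) x) β)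
    (κ : Fin d × Bool) (y : Site d) :
    (Summable fun N => noblePsiN d p (𝐞 κ) (M N) y) ∧
      noblePsiCls d p M (𝐞 κ) y ≤ (p : ℝ) / nobleMu d p * nobleXiCls d p M y := by
  obtain ⟨hΨ, -, -, -⟩ := l1_of_NSumLE (fun _ x => noblePsiN_nonneg' p _ _ x) (NSumLE_noblePsiN hd hp hΞ κ)
  obtain ⟨hX, -, -, -⟩ := l1_of_NSumLE (fun _ x => nobleXiN_nonneg p _ x) hΞ
  refine ⟨hΨ y, ?_⟩
  unfold noblePsiCls nobleXiCls
  rw [← tsum_mul_left]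
  exact (hΨ y).tsum_le_tsum (fun N => noblePsiN_le_mul_nobleXiN hd hp κ (M N) y) ((hX y).mul_left _)

/-- `Π^{[M],ι,κ} ≤ μ̄ Ξ^{[M],ι}` pointwise, with convergence of the defining series ((4.29)).
[cite: FitznerVanDerHofstad2016NoBLE, Assumption 4.2 (4.29) (p. 1086)] -/
theorem noblePiCls_le {β : ℝ} {M : ℕ → ℕ} (ι : Fin d × Bool)
    (hΞ : NSumLE (fun N x => nobleXiIotaN d p (𝐞 ι) (M N) x) β) (κ : Fin d × Bool) (y : Site d) :
    (Summable fun N => noblePiN d p (𝐞 ι) (𝐞 κ) (M N) y) ∧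
      noblePiCls d p M (𝐞 ι) (𝐞 κ) y ≤ (p : ℝ) * nobleXiIotaCls d p M (𝐞 ι) y := by
  obtain ⟨hP, -, -, -⟩ := l1_of_NSumLE (fun _ x => noblePiN_nonneg p _ _ _ x) (NSumLE_noblePiN hd hp ι hΞ κ)
  obtain ⟨hX, -, -, -⟩ := l1_of_NSumLE (fun _ x => nobleXiIotaN_nonneg p _ _ x) hΞ
  refine ⟨hP y, ?_⟩
  unfold noblePiCls nobleXiIotaCls
  rw [← tsum_mul_left]
  exact (hP y).tsum_le_tsum (fun N => noblePiN_le_mul_nobleXiIotaN hd hp (𝐞 ι) (𝐞 κ) (M N) y) ((hX y).mul_left _)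

omit hd hp in
/-- `Σ_N (−1)^N a_{N+2} = Σ_m a_{2m+2} − Σ_m a_{2m+3}`. [folklore] -/
theorem tsum_alternating_shift_two_eq {a : ℕ → ℝ} (he : Summable fun m => a (2 * m + 2))
    (ho : Summable fun m => a (2 * m + 3)) :
    ∑' N, (-1 : ℝ) ^ N * a (N + 2) = ∑' m, a (2 * m + 2) - ∑' m, a (2 * m + 3) :=
  tsum_alternating_eq_even_sub_odd (a := fun N => a (N + 2)) he ho

omit hd hp in
/-- `Σ_N (−1)^N a_{N+1} = Σ_m a_{2m+1} − Σ_m a_{2m+2}`. [folklore] -/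
theorem tsum_alternating_shift_one_eq {a : ℕ → ℝ} (ho : Summable fun m => a (2 * m + 1))
    (he : Summable fun m => a (2 * m + 2)) :
    ∑' N, (-1 : ℝ) ^ N * a (N + 1) = ∑' m, a (2 * m + 1) - ∑' m, a (2 * m + 2) :=
  tsum_alternating_eq_even_sub_odd (a := fun N => a (N + 1)) ho he

/-- **`Ψ^κ = Ψ^{[even],κ} − Ψ^{[odd],κ}`** pointwise. [cite: FitznerVanDerHofstad2016NoBLE, (4.2) (p. 1080); App. D Step 5 ("defined via alternating sequences") (p. 1117)] -/
theorem noblePsi_eq_even_sub_odd (h43 : NobleAssumption43At d p S i) (κ : Fin d × Bool) (y : Site d) :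
    noblePsi d p κ y = noblePsiCls d p (fun N => 2 * N) (𝐞 κ) y - noblePsiCls d p (fun N => 2 * N + 1) (𝐞 κ) y := by
  unfold noblePsi noblePsiCls
  exact tsum_alternating_eq_even_sub_odd (a := fun N => noblePsiN d p (𝐞 κ) N y)
    (noblePsiCls_le hd hp h43.xiEven κ y).1 (noblePsiCls_le hd hp h43.xiOdd κ y).1

/-- **`Ψ^κ = Ψ^{(0),κ} − Ψ^{(1),κ} + (Ψ^{[even ≥ 2],κ} − Ψ^{[odd ≥ 3],κ})`** pointwise.
[cite: FitznerVanDerHofstad2016NoBLE, (4.2) (p. 1080); App. D (D.32) line 4 (the `N ≥ 1` classes) (p. 1117)] -/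
theorem noblePsi_eq_zero_sub_one_add_tail (h43 : NobleAssumption43At d p S i) (κ : Fin d × Bool) (y : Site d) :
    noblePsi d p κ y = noblePsiN d p (𝐞 κ) 0 y - noblePsiN d p (𝐞 κ) 1 y +
      (noblePsiCls d p (fun N => 2 * N + 2) (𝐞 κ) y - noblePsiCls d p (fun N => 2 * N + 3) (𝐞 κ) y) := by
  obtain ⟨hN, -, -, -⟩ := l1_of_NSumLE (fun _ x => noblePsiN_nonneg' p _ _ x) (NSumLE_noblePsiN hd hp h43.xiAbs κ)
  unfold noblePsi noblePsiCls
  rw [tsum_negOnePow_eq_shift_two (hN y), tsum_alternating_shift_two_eq (a := fun N => noblePsiN d p (𝐞 κ) N y)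
    (noblePsiCls_le hd hp h43.xiEvenTail κ y).1 (noblePsiCls_le hd hp h43.xiOddTail κ y).1]

/-- **`Π^{ι,κ} = Π^{(0),ι,κ} − (Π^{[odd],ι,κ} − Π^{[even ≥ 2],ι,κ})`** pointwise.
[cite: FitznerVanDerHofstad2016NoBLE, (4.1)–(4.2) (p. 1080); App. D (D.32) lines 5–6 (p. 1117)] -/
theorem noblePi_eq_zero_sub_tail (h43 : NobleAssumption43At d p S i) (ι κ : Fin d × Bool) (y : Site d) :
    noblePi d p ι κ y = noblePiN d p (𝐞 ι) (𝐞 κ) 0 y -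
      (noblePiCls d p (fun N => 2 * N + 1) (𝐞 ι) (𝐞 κ) y - noblePiCls d p (fun N => 2 * N + 2) (𝐞 ι) (𝐞 κ) y) := by
  obtain ⟨hN, -, -, -⟩ := l1_of_NSumLE (fun _ x => noblePiN_nonneg p _ _ _ x)
    (NSumLE_noblePiN hd hp ι (h43.xiIotaAbs ι) κ)
  unfold noblePi noblePiCls
  rw [tsum_negOnePow_eq_shift_one (hN y),
    tsum_alternating_shift_one_eq (a := fun N => noblePiN d p (𝐞 ι) (𝐞 κ) N y)
      (noblePiCls_le hd hp ι (h43.xiIotaOdd ι) κ y).1 (noblePiCls_le hd hp ι (h43.xiIotaEvenTail ι) κ y).1]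

/-- **`Π^{ι,κ} = Π^{[even],ι,κ} − Π^{[odd],ι,κ}`** pointwise. [cite: FitznerVanDerHofstad2016NoBLE, (4.1)–(4.2) (p. 1080); App. D Step 5 (p. 1117)] -/
theorem noblePi_eq_even_sub_odd (h43 : NobleAssumption43At d p S i) (ι κ : Fin d × Bool) (y : Site d) :
    noblePi d p ι κ y = noblePiCls d p (fun N => 2 * N) (𝐞 ι) (𝐞 κ) y -
      noblePiCls d p (fun N => 2 * N + 1) (𝐞 ι) (𝐞 κ) y := by
  unfold noblePi noblePiCls
  exact tsum_alternating_eq_even_sub_odd (a := fun N => noblePiN d p (𝐞 ι) (𝐞 κ) N y)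
    (noblePiCls_le hd hp ι (h43.xiIotaEven ι) κ y).1 (noblePiCls_le hd hp ι (h43.xiIotaOdd ι) κ y).1

/-- `|Ψ^κ| ≤ (μ̄/μ) Ξ^{[abs]}` pointwise. [cite: FitznerVanDerHofstad2016NoBLE, Assumption 4.2 (4.29) (p. 1086); App. D (D.24) (p. 1115)] -/
theorem abs_noblePsi_le (h43 : NobleAssumption43At d p S i) (κ : Fin d × Bool) (y : Site d) :
    |noblePsi d p κ y| ≤ (p : ℝ) / nobleMu d p * nobleXiCls d p (fun N => N) y := by
  obtain ⟨hN, hle⟩ := noblePsiCls_le hd hp h43.xiAbs κ y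
  unfold noblePsi
  exact (abs_alternating_tsum_le hN fun N => noblePsiN_nonneg' p _ _ y).trans hle

/-- `|Π^{ι,κ}| ≤ μ̄ Ξ^{[abs],ι}` pointwise. [cite: FitznerVanDerHofstad2016NoBLE, Assumption 4.2 (4.29) (p. 1086); App. D (D.24) (p. 1115)] -/
theorem abs_noblePi_le (h43 : NobleAssumption43At d p S i) (ι κ : Fin d × Bool) (y : Site d) :
    |noblePi d p ι κ y| ≤ (p : ℝ) * nobleXiIotaCls d p (fun N => N) (𝐞 ι) y := by
  obtain ⟨hN, hle⟩ := noblePiCls_le hd hp ι (h43.xiIotaAbs ι) κ y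
  unfold noblePi
  exact (abs_alternating_tsum_le hN fun N => noblePiN_nonneg p _ _ _ y).trans hle

end Classes

/-! ## Part C. The displacement constant of `R_{F,z}` produced by the Step-4 bookkeeping

[NoBLE17] App. D Step 5 defines `β_{ΔR,F}` by the nine-line display (D.32) (p. 1117), "obtained by bounding each
term of `R_{F,z}` [(D.31)] using the ideas of Step 4": the geometric-series lines 1–3 (the `n ≥ 2` matrix powers,
cf. (D.29)), line 4 (the `Ψ`-remainders and the `N ≥ 2` classes of `Ψ`), lines 5–6 (the `Π`-remainder, the
`N ≥ 1` classes of `Π` and the three `μ_z`-weighted `Π`-terms of `A u`) and lines 7–9 (the cross terms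
`Ψ^ι ⋆ (A u)_ι`, even/odd classes paired by sign).  `BetaMap.betaRfDeltaLower` (generated, `BetaMap.lean`) is
the notebook function `betaRfDeltaLower` of `General.nb` transcribing that display.  Carrying out the Step-4
bookkeeping for the cross terms `−μ_z Σ_ι Ψ^ι ⋆ (A u)_ι` with `Ψ^ι = Ψ^{[even],ι} − Ψ^{[odd],ι}`,
`Π^{ι,κ} = Π^{[even],ι,κ} − Π^{[odd],ι,κ}` and the one-sided estimates
`−(a_E − a_O) ⋆ (b_E − b_O) ≤ a_E ⋆ b_O + a_O ⋆ b_E`, `(a_E − a_O) ⋆ (b_E − b_O) ≤ a_E ⋆ b_E + a_O ⋆ b_O`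
produces, for the products "displacement of a `Ξ`-class × mass of a `Ξ^ι`-class", the pattern
`(1 + μ²)(β^odd_{ΔΞ} β^odd_{Ξ^ι} + β^even_{ΔΞ} β^even_{Ξ^ι}) + 2μ(β^odd_{ΔΞ} β^even_{Ξ^ι} + β^even_{ΔΞ} β^odd_{Ξ^ι})`
with the prefactor `(2d μ̄_z)²/(1 − μ_z²)²` of lines 8–9, where line 7 of the transcribed display carries
`(1 + μ²) β^odd_{ΔΞ} β^odd_{Ξ^ι} + 2μ β^even_{ΔΞ} β^even_{Ξ^ι}` (programme note DIVERGENCE D65; the generated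
`BetaMap.lean` is not modified).  `betaRfDeltaCorr` below is the constant the bookkeeping yields — lines 1–6
are the magnitudes of the transcribed lines 1–6 verbatim, lines 7–9 the pattern above with the printed
prefactor `(2d μ̄)²/(1 − μ²)²` — and module 3c proves the kernel inequality
`Σ_x ‖x‖₂² m(x) ≤ betaRfDeltaCorr(…)` for a TRS majorant `m ≥ (R_{F,z})₋`. -/

namespace BetaMap

/-- **The (D.32) bookkeeping constant** `β^{corr}_{ΔR,F}(d, μ, μ̄/μ, μ̄, β^abs_Ξ, …, β_{ΔΠR})` (same 27 arguments, in
the same order, as the generated `betaRfDeltaLower`; a POSITIVE number bounding `Σ_x ‖x‖₂² (R_{F,z})₋(x)`):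
lines 1–6 = the magnitudes of lines 1–6 of (D.32) as transcribed in `betaRfDeltaLower`; lines 7–9 = the
cross-term bookkeeping of App. D Step 4 with prefactor `(2dμ̄)²/(1−μ²)²` (see the Part C header; DIVERGENCE D65).
[cite: FitznerVanDerHofstad2016NoBLE, App. D Step 4 (D.24)–(D.28) (pp. 1115–1116) and Step 5 (D.30)–(D.32) (p. 1117)] -/
def betaRfDeltaCorr (d mu PsiToXi muPiToXii XiAbs XiOddAbs XiEvenAbs XiDeltaAbs XiDeltaOddAbs XiDeltaEvenAbs XigeqTwoOddAbs XiDeltageqTwoOddAbs XiDeltageqTwoEven PsiROneDeltaI PsiRZeroDeltaII XiIotaAbs XiIotaOddAbs XiIotaEvenAbs XiIotaDeltaEi XiIotaDeltaEiOdd XiIotaDeltaEiEven XiIotaDeltaZero XiIotaDeltaZeroOdd XiIotaDeltaZeroEven XiIotageqOneEven XiIotaDeltageqOneEven betaPiRDelta : ℝ) : ℝ :=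
  let tmp2 := (2*d*muPiToXii)/(1-mu)*XiIotaAbs
  let l1 := (2*d*mu)/(1-mu)*PsiToXi*XiDeltaAbs*(tmp2^2)/(1-tmp2)
  let l2 := ((2*d)^2*mu*muPiToXii)/((1-mu^2)*(1-mu))*tmp2/((1-tmp2)^2)*(1+PsiToXi*XiAbs)*(XiIotaDeltaEi + mu*XiIotaDeltaZero)
  let l3 := ((2*d)^2*mu*muPiToXii)/((1-mu^2)*(1-mu))*tmp2/(1-tmp2)*(1+PsiToXi*XiAbs)*(XiIotaDeltaEi + mu*XiIotaDeltaZero + XiIotaAbs)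
  let l4 := (2*d*mu)/(1-mu^2)*(PsiROneDeltaI + mu*PsiRZeroDeltaII + PsiToXi*(XiDeltageqTwoOddAbs + XigeqTwoOddAbs + mu*XiDeltageqTwoEven))
  let l5 := mu/((1-mu^2)^2)*(betaPiRDelta + (2*d)^2*muPiToXii*(XiIotaDeltageqOneEven + XiIotageqOneEven))
  let l6 := ((2*d)^2*muPiToXii*mu^2)/((1-mu^2)^2)*(XiIotaDeltaEiOdd + XiIotaDeltaZeroOdd + XiIotaOddAbs + mu*XiIotaDeltaZeroEven)
  let K := ((2*d)^2*muPiToXii^2)/((1-mu^2)^2)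
  let l7 := K*((1+mu^2)*(XiDeltaOddAbs*XiIotaOddAbs + XiDeltaEvenAbs*XiIotaEvenAbs) + 2*mu*(XiDeltaOddAbs*XiIotaEvenAbs + XiDeltaEvenAbs*XiIotaOddAbs))
  let l8 := K*XiOddAbs*(XiIotaDeltaEiOdd + XiIotaOddAbs + mu*XiIotaDeltaZeroEven + mu*XiIotaEvenAbs + mu*XiIotaDeltaEiEven + mu^2*XiIotaDeltaZeroOdd)
  let l9 := K*XiEvenAbs*(XiIotaDeltaEiEven + XiIotaEvenAbs + mu*XiIotaDeltaZeroOdd + mu*XiIotaOddAbs + mu*XiIotaDeltaEiOdd + mu^2*XiIotaDeltaZeroEven)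
  l1 + l2 + l3 + l4 + l5 + l6 + l7 + l8 + l9

/-- **Bookkeeping identity**: `β^{corr}_{ΔR,F} + β̲_{ΔR,F}` (the generated `betaRfDeltaLower` is the NEGATIVE lower bound)
is the explicit lines-7–9 difference — lines 1–6 cancel identically.  (A `ring` identity; its sign at a given
input tuple is a `norm_num` evaluation, not a theorem about all tuples.) [folklore] -/
theorem betaRfDeltaCorr_add_betaRfDeltaLower (d mu PsiToXi muPiToXii XiAbs XiOddAbs XiEvenAbs XiDeltaAbs XiDeltaOddAbs XiDeltaEvenAbs XigeqTwoOddAbs XiDeltageqTwoOddAbs XiDeltageqTwoEven PsiROneDeltaI PsiRZeroDeltaII XiIotaAbs XiIotaOddAbs XiIotaEvenAbs XiIotaDeltaEi XiIotaDeltaEiOdd XiIotaDeltaEiEven XiIotaDeltaZero XiIotaDeltaZeroOdd XiIotaDeltaZeroEven XiIotageqOneEven XiIotaDeltageqOneEven betaPiRDelta : ℝ) :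
    betaRfDeltaCorr d mu PsiToXi muPiToXii XiAbs XiOddAbs XiEvenAbs XiDeltaAbs XiDeltaOddAbs XiDeltaEvenAbs XigeqTwoOddAbs XiDeltageqTwoOddAbs XiDeltageqTwoEven PsiROneDeltaI PsiRZeroDeltaII XiIotaAbs XiIotaOddAbs XiIotaEvenAbs XiIotaDeltaEi XiIotaDeltaEiOdd XiIotaDeltaEiEven XiIotaDeltaZero XiIotaDeltaZeroOdd XiIotaDeltaZeroEven XiIotageqOneEven XiIotaDeltageqOneEven betaPiRDelta + betaRfDeltaLower d mu PsiToXi muPiToXii XiAbs XiOddAbs XiEvenAbs XiDeltaAbs XiDeltaOddAbs XiDeltaEvenAbs XigeqTwoOddAbs XiDeltageqTwoOddAbs XiDeltageqTwoEven PsiROneDeltaI PsiRZeroDeltaII XiIotaAbs XiIotaOddAbs XiIotaEvenAbs XiIotaDeltaEi XiIotaDeltaEiOdd XiIotaDeltaEiEven XiIotaDeltaZero XiIotaDeltaZeroOdd XiIotaDeltaZeroEven XiIotageqOneEven XiIotaDeltageqOneEven betaPiRDelta =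
      ((2*d)^2*muPiToXii^2)/((1-mu^2)^2) *
          ((1+mu^2)*(XiDeltaOddAbs*XiIotaOddAbs + XiDeltaEvenAbs*XiIotaEvenAbs)
            + 2*mu*(XiDeltaOddAbs*XiIotaEvenAbs + XiDeltaEvenAbs*XiIotaOddAbs)
            + XiOddAbs*(XiIotaDeltaEiOdd + XiIotaOddAbs + mu*XiIotaDeltaZeroEven + mu*XiIotaEvenAbs
                + mu*XiIotaDeltaEiEven + mu^2*XiIotaDeltaZeroOdd)
            + XiEvenAbs*(XiIotaDeltaEiEven + XiIotaEvenAbs + mu*XiIotaDeltaZeroOdd + mu*XiIotaOddAbs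
                + mu*XiIotaDeltaEiOdd + mu^2*XiIotaDeltaZeroEven))
        - ((2*d)^2*muPiToXii*mu)/((1-mu^2)^2) *
          (XiDeltaOddAbs*XiIotaOddAbs*(1+mu^2) + 2*mu*XiDeltaEvenAbs*XiIotaEvenAbs
            + XiOddAbs*(XiIotaDeltaEiOdd + XiIotaOddAbs + mu*XiIotaDeltaZeroEven + mu*XiIotaEvenAbs
                + mu*XiIotaDeltaEiEven + mu^2*XiIotaDeltaZeroOdd))
        - ((2*d)^2*muPiToXii*mu)/((1-mu^2)*(1-mu)) *
          (XiEvenAbs*(XiIotaDeltaEiEven + XiIotaEvenAbs + mu*XiIotaDeltaZeroOdd + mu*XiIotaOddAbs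
            + mu*XiIotaDeltaEiOdd + mu^2*XiIotaDeltaZeroEven)) := by
  simp only [betaRfDeltaCorr, betaRfDeltaLower]
  ring

/-- **The `NobleBeta` table with the bookkeeping constant in the `βΔ` slot**: the seven other fields are those of
the generated `nobleBetaOfInputs` (wiring of `Percolation.nb` In[1218]–[1237]); `βΔ := β^{corr}_{ΔR,F}` of the
same 27 input fields, in the same order, as the generated `βΔ := −betaRfDeltaLower(…)`.
[cite: FitznerVanDerHofstad2016NoBLE, App. D pp. 1110–1117, (D.32); FitznerVanDerHofstad2017, §2.5 p. 16 and notebook Percolation.nb In[1218]–[1237]] -/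
def nobleBetaOfInputsCorr (d : ℝ) (i : Inputs) : NobleBeta :=
  { nobleBetaOfInputs d i with
    βΔ := betaRfDeltaCorr d i.mu i.mubOverMu i.mub i.xiAbs i.xiOdd i.xiEven i.xiDeltaAbs i.xiOddDelta i.xiEvenDelta i.xiOddTail i.xiOddTailDelta i.xiEvenTailDelta i.psiRI1Delta i.psiRII0Delta i.xiIotaAbs i.xiIotaOdd i.xiIotaEven i.xiIotaDeltaEi i.xiIotaOddDeltaEi i.xiIotaEvenDeltaEi i.xiIotaDeltaZero i.xiIotaOddDeltaZero i.xiIotaEvenDeltaZero i.xiIotaEvenTail i.xiIotaEvenTailDeltaEi i.piR0DeltaEiEk }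

variable {dR : ℝ} {i : Inputs}

/-- [folklore] -/
@[simp] theorem nobleBetaOfInputsCorr_βμ : (nobleBetaOfInputsCorr dR i).βμ = (nobleBetaOfInputs dR i).βμ := rfl
/-- [folklore] -/
@[simp] theorem nobleBetaOfInputsCorr_βPi : (nobleBetaOfInputsCorr dR i).βPi = (nobleBetaOfInputs dR i).βPi := rfl
/-- [folklore] -/
@[simp] theorem nobleBetaOfInputsCorr_βΨ : (nobleBetaOfInputsCorr dR i).βΨ = (nobleBetaOfInputs dR i).βΨ := rfl
/-- [folklore] -/
@[simp] theorem nobleBetaOfInputsCorr_cΦup : (nobleBetaOfInputsCorr dR i).cΦup = (nobleBetaOfInputs dR i).cΦup := rfl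
/-- [folklore] -/
@[simp] theorem nobleBetaOfInputsCorr_βαΦ : (nobleBetaOfInputsCorr dR i).βαΦ = (nobleBetaOfInputs dR i).βαΦ := rfl
/-- [folklore] -/
@[simp] theorem nobleBetaOfInputsCorr_βRΦ : (nobleBetaOfInputsCorr dR i).βRΦ = (nobleBetaOfInputs dR i).βRΦ := rfl
/-- [folklore] -/
@[simp] theorem nobleBetaOfInputsCorr_αFlow : (nobleBetaOfInputsCorr dR i).αFlow = (nobleBetaOfInputs dR i).αFlow := rfl

/-- The `βΔ` slot of the corrected table. [folklore] -/
theorem nobleBetaOfInputsCorr_βΔ :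
    (nobleBetaOfInputsCorr dR i).βΔ = betaRfDeltaCorr dR i.mu i.mubOverMu i.mub i.xiAbs i.xiOdd i.xiEven i.xiDeltaAbs i.xiOddDelta i.xiEvenDelta i.xiOddTail i.xiOddTailDelta i.xiEvenTailDelta i.psiRI1Delta i.psiRII0Delta i.xiIotaAbs i.xiIotaOdd i.xiIotaEven i.xiIotaDeltaEi i.xiIotaOddDeltaEi i.xiIotaEvenDeltaEi i.xiIotaDeltaZero i.xiIotaOddDeltaZero i.xiIotaEvenDeltaZero i.xiIotaEvenTail i.xiIotaEvenTailDeltaEi i.piR0DeltaEiEk := rfl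

end BetaMap

end Literature.Probability.FitznerVanDerHofstad2017

end
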